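import Literature.NumberTheory.Sieve.BVTotallyRealBound
import Literature.NumberTheory.Sieve.BombieriVinogradovTotallyReal
import HarnessLib

/-!
# Bombieri–Vinogradov over totally real fields (Hinz 1988), from Mitsui's prime number theorem

Topic `Literature/NumberTheory/Sieve`, sub-namespace `BVAssembly` (conclusion). The parameter
choice of Hinz's Theorem (pp. 177–178, 191–192) in the smooth-weight form of this tree:
with `L = log N`, `ε = e^a = L^{−(b₀+2)}`, `U = Q₁ = L^{e₁}`, the bound `sum_Ecube_le` fed with
`chain_at_t` gives `∑_{N𝔮≤Q} E(A₀(M); 𝔮) ≪ N^d L^{−b₀}` for `M ∈ {N, 2N}` and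
`Q ≤ |A(N)|^θ`, `θ < 1/2`; with `primesAErr_le_Ecube_add` this is the level of distribution
`θ` of the primes of `K` in the sense of Castillo–Hall–Lemke Oliver–Pollack–Thompson
(`MaynardNF.PrimesHaveLevel K θ`) for every `θ < 1/2` — GIVEN Mitsui's prime number theorem for
classes in balanced boxes (the explicit hypothesis `hPNT`, [Mitsui1956, Main Theorem]).

* `primesHaveLevel_of_PNT` — the main result;
* `castilloEtAl2015_thm_2_7_hinz_of_PNT`, `castilloEtAl2015_thm_1_1_totallyReal_of_PNT` — the
  tree's named facts (Castillo et al. Theorem 2.7 / Theorem 1.1, totally real) from the Mitsui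
  hypothesis for all totally real fields.

## References

* J. Hinz, Acta Arith. 51 (1988), Theorem and §5. [cite: Hinz1988, §1 (1.6), §5 pp. 191–192]
* T. Mitsui, Jap. J. Math. 26 (1956), Main Theorem. [cite: Mitsui1956, Main Theorem (p. 1; §4 (4.38))]
* A. Castillo et al., Proc. AMS 143 (2015), §2.1 and Theorem 2.7. [cite: CastilloEtAl2015, §2.1]
-/

noncomputable section

open Finset NumberField NumberField.InfinitePlace MeasureTheory Set Filter
  Literature.NumberTheory.Sieve.NumberFieldLS Literature.NumberTheory.Sieve.BoxPrimes
  Literature.NumberTheory.LFunctions Literature.NumberTheory.LFunctions.NumberField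
  Literature.NumberTheory.Sieve.CastilloEtAl2015 Literature.NumberTheory.Sieve.TypeTwoReparam
  Literature.NumberTheory.Sieve.TypeTwoBlock Literature.NumberTheory.Sieve.SmoothCoset
  Literature.NumberTheory.Sieve.SmoothBVCore Literature.NumberTheory.Sieve.SmoothBVModuli
  Literature.NumberTheory.Sieve.SmoothStepA Literature.NumberTheory.Sieve.LogIntegral
  Literature.NumberTheory.Sieve.SmoothToSharp Literature.NumberTheory.Sieve.SmoothWeights
  Literature.NumberTheory.Sieve.ProfileConst Literature.NumberTheory.Sieve.MitsuiPNT
  Literature.NumberTheory.Sieve.SmoothSmallModuli Literature.NumberTheory.Sieve.PrimRed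
  Literature.NumberTheory.Sieve.LogSep Literature.NumberTheory.Sieve.TypeTwoBound
  Literature.NumberTheory.Sieve.TypeTwoCoeff Literature.NumberTheory.Sieve.Balanced
  Literature.NumberTheory.Sieve.SmoothTypeOne Literature.NumberTheory.LFunctions.HeckeCone
  NumberField.Units NumberField.Units.dirichletUnitTheorem Literature.NumberTheory.Sieve.MaynardNF
  Literature.NumberTheory.Sieve.SmoothPrimePowers Literature.NumberTheory.Sieve.TotientHarmonic
open scoped Classical nonZeroDivisors

namespace Literature.NumberTheory.Sieve.BVAssembly

variable {K : Type*} [Field K] [NumberField K] [IsTotallyReal K]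

local notation "d" => Module.finrank ℚ K
local notation "RP" => {w : InfinitePlace K // IsReal w}
local notation "rk" => Module.finrank ℝ (logSpace K)

/-! ## The parameters as functions of `L = log N` -/

omit [NumberField K] [IsTotallyReal K] in
/-- **The basic parameter facts.** With `PL ≥ (4b₀+10)²`, `ε = (PL^{b₀+2})⁻¹`, `a = log ε`:
`1 ≤ PL`, `0 < ε ≤ 1`, `a ≤ −ε ≤ 0`, `e^a = ε`, `log 2 − a + 3 ≤ PL/2`. [folklore] -/
theorem param_facts (b₀ : ℕ) {PL : ℝ} (hPL : ((4 * b₀ + 10 : ℕ) : ℝ) ^ 2 ≤ PL) :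
    1 ≤ PL ∧ 0 < (PL ^ (b₀ + 2))⁻¹ ∧ (PL ^ (b₀ + 2))⁻¹ ≤ 1 ∧
      Real.log ((PL ^ (b₀ + 2))⁻¹) ≤ -(PL ^ (b₀ + 2))⁻¹ ∧ Real.log ((PL ^ (b₀ + 2))⁻¹) ≤ 0 ∧
      Real.exp (Real.log ((PL ^ (b₀ + 2))⁻¹)) = (PL ^ (b₀ + 2))⁻¹ ∧
      Real.log 2 - Real.log ((PL ^ (b₀ + 2))⁻¹) + 3 ≤ PL / 2 ∧
      Real.log ((PL ^ (b₀ + 2))⁻¹) = -((b₀ + 2 : ℕ) * Real.log PL) := by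
  have hb : (10 : ℝ) ≤ (4 * b₀ + 10 : ℕ) := by exact_mod_cast (by omega : 10 ≤ 4 * b₀ + 10)
  have h100 : (100 : ℝ) ≤ PL := le_trans (by nlinarith) hPL
  have hPL1 : 1 ≤ PL := by linarith
  have hPL0 : 0 < PL := by linarith
  have hpow1 : 1 ≤ PL ^ (b₀ + 2) := one_le_pow₀ hPL1
  have hε0 : 0 < (PL ^ (b₀ + 2))⁻¹ := by positivity
  have hε1 : (PL ^ (b₀ + 2))⁻¹ ≤ 1 := inv_le_one_of_one_le₀ hpow1
  have hlogε : Real.log ((PL ^ (b₀ + 2))⁻¹) = -((b₀ + 2 : ℕ) * Real.log PL) := by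
    rw [Real.log_inv, Real.log_pow]
  have hlogPL1 : 1 ≤ Real.log PL := by
    rw [← Real.log_exp 1]
    refine Real.log_le_log (Real.exp_pos 1) (le_trans ?_ h100)
    have := Real.exp_one_lt_d9; norm_num at this; linarith
  have hlogPL : Real.log PL ≤ 2 * Real.sqrt PL := by
    -- `log x = 2 log √x ≤ 2(√x − 1) ≤ 2√x`
    have h1 : Real.log (Real.sqrt PL) ≤ Real.sqrt PL - 1 := Real.log_le_sub_one_of_pos (Real.sqrt_pos.2 hPL0)
    have h2 : Real.log PL = 2 * Real.log (Real.sqrt PL) := by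
      rw [← Real.log_rpow (Real.sqrt_pos.2 hPL0) 2]
      congr 1
      rw [Real.rpow_two, Real.sq_sqrt hPL0.le]
    linarith
  have hsq : ((4 * b₀ + 10 : ℕ) : ℝ) ≤ Real.sqrt PL := by
    rw [← Real.sqrt_sq (by positivity : (0 : ℝ) ≤ (4 * b₀ + 10 : ℕ))]
    exact Real.sqrt_le_sqrt hPL
  have hsqrt_sq : Real.sqrt PL * Real.sqrt PL = PL := Real.mul_self_sqrt hPL0.le
  refine ⟨hPL1, hε0, hε1, ?_, ?_, Real.exp_log hε0, ?_, hlogε⟩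
  · rw [hlogε]
    have : (1 : ℝ) ≤ (b₀ + 2 : ℕ) * Real.log PL := by
      have h2 : (1 : ℝ) ≤ (b₀ + 2 : ℕ) := by exact_mod_cast (by omega : 1 ≤ b₀ + 2)
      nlinarith
    linarith
  · rw [hlogε]
    have : (0 : ℝ) ≤ (b₀ + 2 : ℕ) * Real.log PL := by positivity
    linarith
  · rw [hlogε]
    have hl2 : Real.log 2 ≤ 1 := by
      have := Real.log_two_lt_d9; linarith
    -- `(b₀+2) log PL ≤ 2(b₀+2)√PL` and `√PL ≥ 4b₀+10`
    have h1 : ((b₀ + 2 : ℕ) : ℝ) * Real.log PL ≤ 2 * (b₀ + 2 : ℕ) * Real.sqrt PL := by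
      have : (0 : ℝ) ≤ (b₀ + 2 : ℕ) := by positivity
      nlinarith
    have h2 : (2 * (b₀ + 2 : ℕ) * Real.sqrt PL + 4 : ℝ) ≤ PL / 2 := by
      have hb' : (2 * (b₀ + 2 : ℕ) + 1 : ℝ) * 2 ≤ (4 * b₀ + 10 : ℕ) := by push_cast; linarith
      have hs10 : (10 : ℝ) ≤ Real.sqrt PL := hb.trans hsq
      nlinarith
    linarith

omit [NumberField K] [IsTotallyReal K] in
/-- **Cube-side facts**: for `N > 0`, `PL = log N ≥ 2`, `N ≤ M ≤ 2N`: `3 ≤ M`, `PL ≤ log M ≤ 2PL`,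
`1 + log M ≤ 3PL`, `N^n ≤ M^n ≤ 2^n N^n`. [folklore] -/
theorem cube_facts {N PL M : ℝ} (hN0 : 0 < N) (hN : Real.log N = PL) (hPL : 2 ≤ PL) (hNM : N ≤ M) (hM2 : M ≤ 2 * N) (n : ℕ) :
    3 ≤ M ∧ PL ≤ Real.log M ∧ Real.log M ≤ 2 * PL ∧ 1 + Real.log M ≤ 3 * PL ∧
      N ^ n ≤ M ^ n ∧ M ^ n ≤ 2 ^ n * N ^ n := by
  have hN3 : 3 ≤ N := by
    have h := Real.exp_log hN0
    rw [hN] at h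
    rw [← h]
    have : Real.exp 2 ≤ Real.exp PL := Real.exp_le_exp.2 hPL
    have h2 : (3 : ℝ) ≤ Real.exp 2 := by
      have := Real.add_one_le_exp (2 : ℝ); linarith
    linarith
  have hM0 : 0 < M := by linarith
  have hlogM_lo : PL ≤ Real.log M := hN ▸ Real.log_le_log hN0 hNM
  have hlogM_hi : Real.log M ≤ 2 * PL := by
    have h1 : Real.log M ≤ Real.log (2 * N) := Real.log_le_log hM0 hM2
    rw [Real.log_mul two_ne_zero hN0.ne', hN] at h1
    have hl2 : Real.log 2 ≤ 1 := by have := Real.log_two_lt_d9; linarith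
    linarith
  refine ⟨by linarith, hlogM_lo, hlogM_hi, by linarith, pow_le_pow_left₀ hN0.le hNM n, ?_⟩
  calc M ^ n ≤ (2 * N) ^ n := pow_le_pow_left₀ hM0.le hM2 n
    _ = 2 ^ n * N ^ n := mul_pow _ _ _

omit [NumberField K] [IsTotallyReal K] in
/-- **`A_ε/den ≤ (2/d)(1+K₃)^d PL^{3d(b₀+2)+d−1}`** under the parameter facts. [folklore] -/
theorem Aeden_le (b₀ : ℕ) {PL a ε LM : ℝ} (n : ℕ) (hn : 0 < n) (hPL1 : 1 ≤ PL)
    (hε : ε = (PL ^ (b₀ + 2))⁻¹) (hla : Real.log 2 - a + 3 ≤ PL / 2) (ha0 : a ≤ 0) (hLM : PL ≤ LM) :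
    ((Real.log 2 - a + 3) * ((1 + K3) * (ε ^ 3)⁻¹)) ^ n / (n * LM - n * (Real.log 2 - a) - 3 * n) ≤
      (2 / n) * (1 + K3) ^ n * PL ^ (3 * n * (b₀ + 2) + n - 1) := by
  have hl2 := Real.log_pos one_lt_two
  have hK3 := K3_nonneg
  have hPL0 : 0 < PL := by linarith
  have hnR : (0 : ℝ) < n := by exact_mod_cast hn
  -- numerator
  have hε3 : (ε ^ 3)⁻¹ = PL ^ (3 * (b₀ + 2)) := by
    rw [hε, inv_pow, inv_inv, ← pow_mul, mul_comm]
  have hnum : ((Real.log 2 - a + 3) * ((1 + K3) * (ε ^ 3)⁻¹)) ^ n ≤ ((1 + K3) ^ n * PL ^ (3 * n * (b₀ + 2) + n)) := by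
    rw [hε3]
    have h1 : (Real.log 2 - a + 3) * ((1 + K3) * PL ^ (3 * (b₀ + 2))) ≤ (1 + K3) * PL ^ (3 * (b₀ + 2) + 1) := by
      have hla' : Real.log 2 - a + 3 ≤ PL := by linarith
      have h0 : 0 ≤ (1 + K3) * PL ^ (3 * (b₀ + 2)) := by positivity
      calc (Real.log 2 - a + 3) * ((1 + K3) * PL ^ (3 * (b₀ + 2))) ≤ PL * ((1 + K3) * PL ^ (3 * (b₀ + 2))) :=
            mul_le_mul_of_nonneg_right hla' h0
        _ = (1 + K3) * PL ^ (3 * (b₀ + 2) + 1) := by rw [pow_succ]; ring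
    calc ((Real.log 2 - a + 3) * ((1 + K3) * PL ^ (3 * (b₀ + 2)))) ^ n ≤ ((1 + K3) * PL ^ (3 * (b₀ + 2) + 1)) ^ n :=
          pow_le_pow_left₀ (mul_nonneg (by linarith) (by positivity)) h1 n
      _ = (1 + K3) ^ n * PL ^ (3 * n * (b₀ + 2) + n) := by
          rw [mul_pow, ← pow_mul]
          congr 2
          ring
  -- denominator
  have hden : n * PL / 2 ≤ n * LM - n * (Real.log 2 - a) - 3 * n := by
    have : n * LM - n * (Real.log 2 - a) - 3 * n = n * (LM - (Real.log 2 - a + 3)) := by ring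
    rw [this]
    have h2 : PL / 2 ≤ LM - (Real.log 2 - a + 3) := by linarith
    calc n * PL / 2 = n * (PL / 2) := by ring
      _ ≤ n * (LM - (Real.log 2 - a + 3)) := mul_le_mul_of_nonneg_left h2 hnR.le
  have hden0 : 0 < n * PL / 2 := by positivity
  calc ((Real.log 2 - a + 3) * ((1 + K3) * (ε ^ 3)⁻¹)) ^ n / (n * LM - n * (Real.log 2 - a) - 3 * n)
      ≤ ((1 + K3) ^ n * PL ^ (3 * n * (b₀ + 2) + n)) / (n * PL / 2) :=
        div_le_div₀ (by positivity) hnum hden0 hden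
    _ = (2 / n) * (1 + K3) ^ n * (PL ^ (3 * n * (b₀ + 2) + n) / PL) := by
        field_simp
    _ = (2 / n) * (1 + K3) ^ n * PL ^ (3 * n * (b₀ + 2) + n - 1) := by
        congr 1
        rw [div_eq_iff hPL0.ne', ← pow_succ]
        congr 1
        omega

omit [NumberField K] [IsTotallyReal K] in
/-- Killing the power-saving junk: `N^{−η} PL^p ≤ (PL^{b₀})⁻¹` once `PL^{p+b₀} ≤ N^η`. [folklore] -/
theorem junk_kill {N PL η : ℝ} {p b₀ : ℕ} (hN : 0 < N) (hPL1 : 1 ≤ PL) (h : PL ^ (p + b₀) ≤ N ^ η) :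
    N ^ (-η) * PL ^ p ≤ (PL ^ b₀)⁻¹ := by
  have hNη : 0 < N ^ η := Real.rpow_pos_of_pos hN η
  rw [Real.rpow_neg hN.le, ← div_eq_inv_mul, div_le_iff₀ hNη, ← div_eq_inv_mul, le_div_iff₀ (by positivity),
    ← pow_add]
  exact h

omit [NumberField K] [IsTotallyReal K] in
/-- The `N`-power bookkeeping of the junk terms (`N ≥ 1`, `0 < θ < 1/2`, `0 < η ≤ min(d(1/2−θ), 1/2)`):
`N^{dθ} ≤ N^d N^{−η}`, `N^{dθ}√(N^d) ≤ N^d N^{−η}`, `(N^{dθ})³ ≤ N^d N^d N^{−η}`,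
`N^{d−1} ≤ N^d N^{−η}`, `N^{d−1} N^θ ≤ N^d N^{−η}`, `√(N^d) ≤ N^d N^{−η}`, `1 ≤ N^d N^{−η}`. [folklore] -/
theorem Npow_facts {N θ η : ℝ} (n : ℕ) (hn : 1 ≤ n) (hN : 1 ≤ N) (hθ0 : 0 < θ) (hθ : θ < 1 / 2) (hη0 : 0 < η)
    (hηθ : η ≤ n * (1 / 2 - θ)) (hη1 : η ≤ 1 / 2) :
    N ^ (n * θ) ≤ N ^ n * N ^ (-η) ∧ N ^ (n * θ) * Real.sqrt (N ^ n) ≤ N ^ n * N ^ (-η) ∧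
      (N ^ (n * θ)) ^ 3 ≤ N ^ n * N ^ n * N ^ (-η) ∧ N ^ (n - 1) ≤ N ^ n * N ^ (-η) ∧
      N ^ (n - 1) * N ^ θ ≤ N ^ n * N ^ (-η) ∧ Real.sqrt (N ^ n) ≤ N ^ n * N ^ (-η) ∧ 1 ≤ N ^ n * N ^ (-η) := by
  have hN0 : 0 < N := by linarith
  have hnR : (1 : ℝ) ≤ n := by exact_mod_cast hn
  -- everything as real powers of `N`
  have hpow : ∀ x : ℝ, N ^ n * N ^ (-η) = N ^ ((n : ℝ) - η) := fun x => by
    rw [← Real.rpow_natCast, ← Real.rpow_add hN0]; ring_nf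
  have hsqrt : Real.sqrt (N ^ n) = N ^ ((n : ℝ) / 2) := by
    rw [Real.sqrt_eq_rpow, ← Real.rpow_natCast, ← Real.rpow_mul hN0.le]; ring_nf
  have hle : ∀ x y : ℝ, x ≤ y → N ^ x ≤ N ^ y := fun x y h => Real.rpow_le_rpow_of_exponent_le hN h
  have hηn : η ≤ (n : ℝ) / 2 := by nlinarith
  refine ⟨?_, ?_, ?_, ?_, ?_, ?_, ?_⟩
  · rw [hpow 0]; exact hle _ _ (by nlinarith)
  · rw [hpow 0, hsqrt, ← Real.rpow_add hN0]; exact hle _ _ (by nlinarith)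
  · rw [← Real.rpow_natCast (N ^ (n * θ)) 3, ← Real.rpow_mul hN0.le, show N ^ n * N ^ n * N ^ (-η) = N ^ ((n : ℝ) + n - η) by
      rw [← Real.rpow_natCast, ← Real.rpow_add hN0, ← Real.rpow_add hN0]; ring_nf]
    exact hle _ _ (by push_cast; nlinarith)
  · rw [hpow 0, ← Real.rpow_natCast]
    refine hle _ _ ?_
    rw [Nat.cast_sub hn]; push_cast; linarith
  · rw [hpow 0, ← Real.rpow_natCast, ← Real.rpow_add hN0]
    refine hle _ _ ?_
    rw [Nat.cast_sub hn]; push_cast; linarith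
  · rw [hpow 0, hsqrt]; exact hle _ _ (by linarith)
  · rw [hpow 0]; exact Real.one_le_rpow hN (by linarith)

/-! ## The structural bound for one cube -/

omit [IsTotallyReal K] in
/-- The coset-layer sum: `∑_𝔮 (X/(N𝔮 √D) + 2C_G(1 + (M^d/N𝔮)^{1−1/d})) ≤
X/√D · ∑ 1/N𝔮 + 2C_G(#I(Q) + (M^d)^{1−1/d} Q^{1/d} ∑ 1/N𝔮)`. [folklore] -/
theorem sum_coset_layer_le {CG X M Q : ℝ} (hCG0 : 0 ≤ CG) (hM : 0 < M) (hQ : 1 ≤ Q) :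
    ∑ 𝔮 ∈ idealsLE K Q, (X / (Ideal.absNorm 𝔮 * √|(discr K : ℝ)|) + 2 * CG * (1 + (M ^ d / Ideal.absNorm 𝔮) ^ (1 - 1 / (d : ℝ)))) ≤
      X / √|(discr K : ℝ)| * ∑ 𝔮 ∈ idealsLE K Q, ((Ideal.absNorm 𝔮 : ℕ) : ℝ)⁻¹ +
        2 * CG * ((idealsLE K Q).card + (M ^ d) ^ (1 - 1 / (d : ℝ)) * Q ^ (1 / (d : ℝ)) *
          ∑ 𝔮 ∈ idealsLE K Q, ((Ideal.absNorm 𝔮 : ℕ) : ℝ)⁻¹) := by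
  rw [Finset.sum_add_distrib]
  refine add_le_add (le_of_eq ?_) ?_
  · rw [Finset.mul_sum]
    refine Finset.sum_congr rfl fun 𝔮 _ => ?_
    rw [div_mul_eq_div_div]
    ring
  · rw [← Finset.mul_sum, Finset.sum_add_distrib, Finset.sum_const, nsmul_eq_mul, mul_one]
    refine mul_le_mul_of_nonneg_left (add_le_add le_rfl ?_) (by positivity)
    exact sum_rpow_quot_le hM hQ

/-- **The structural bound for one cube** (`sum_Ecube_le` fed with `chain_at_t`): all constants as
hypotheses, parameters `a ≤ −ε`, `0 < ε ≤ 1`, `e^a`-box conditions, `1 ≤ U ≤ Q' ≤ M^d`, `3 ≤ M`.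
[cite: Hinz1988, §2 pp. 177–178] -/
theorem cube_struct {C : ℝ}
    (hcore : ∀ (a ε t : ℝ), a ≤ 0 → 0 < ε → ε ≤ 1 → 0 ≤ t →
      ∀ (M U Q₁ Q : ℝ), 3 ≤ M → 1 ≤ U → 1 ≤ Q₁ → Q₁ ≤ Q → Q ≤ M ^ d →
      ∑ 𝔣 ∈ (idealsLE K Q).filter (fun 𝔣 => Q₁ < Ideal.absNorm 𝔣),
          (∑ χ ∈ primChars K 𝔣, ‖psiΩ K χ (kappaT a ε t) M‖) / Nat.card ((𝓞 K ⧸ 𝔣)ˣ) ≤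
        PD a ε t ^ d * (C * ((1 + Real.log M) ^ rk * (idealsLE K Q).card * (Real.log U * (idealsLE K U).card) +
          (48 * Real.exp (-3 * a)) ^ d / M ^ d * ((U * Real.log U * (idealsLE K U).card) * (U * (idealsLE K U).card) +
            (d * Real.log M + Real.log U + d) * (U * (idealsLE K U).card)) * (Q ^ 2 * (idealsLE K Q).card) +
          decInt ^ d * Real.log M ^ (rk + 3) * Real.sqrt (harmU K U ^ 3) *
            (Q * Real.sqrt (M ^ d) + M ^ d / Real.sqrt U + M ^ d / Q₁))))
    {Cg : ℝ} (hCg0 : 0 ≤ Cg)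
    (hCg : ∀ X : ℝ, 1 ≤ X → ∀ I : Ideal (𝓞 K),
      (Nat.card {α : 𝓞 K // α ∈ box₀ K X ∧ Ideal.span {α} = I} : ℝ) ≤ Cg * (1 + Real.log X) ^ rk)
    {Cb : ℝ} (hCb1 : 1 ≤ Cb)
    (hbal : ∀ s : InfinitePlace K → ℝ, (∀ w, 0 < s w) → ∃ u : (𝓞 K)ˣ, u ∈ posUnits K ∧
      ∀ w : InfinitePlace K, w ((u : 𝓞 K) : K) * s w ≤ Cb * (∏ w', s w') ^ (1 / (d : ℝ)))
    {A c CP x₀ : ℝ} (hc : 0 < c) (hCP : 0 ≤ CP) (hA : 0 ≤ A)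
    (hPNT : ∀ y : RP → ℝ, x₀ ≤ ∏ w, y w →
      (∀ w, (Cb ^ (d - 1))⁻¹ * (∏ w', y w') ^ (1 / (d : ℝ)) ≤ y w ∧ y w ≤ Cb * (∏ w', y w') ^ (1 / (d : ℝ))) →
      ∀ 𝔮 : Ideal (𝓞 K), 𝔮 ≠ ⊥ → (Ideal.absNorm 𝔮 : ℝ) ≤ Real.log (∏ w, y w) ^ A →
      ∀ γ : (𝓞 K ⧸ 𝔮)ˣ, |(primeBoxCount K y 𝔮 (γ : 𝓞 K ⧸ 𝔮) : ℝ) - mitsuiMain K y / Nat.card ((𝓞 K ⧸ 𝔮)ˣ)| ≤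
        CP * (∏ w, y w) * Real.exp (-(c * Real.sqrt (Real.log (∏ w, y w)))))
    {CG : ℝ} (hCG0 : 0 ≤ CG)
    (hCG : ∀ (𝔮 : (Ideal (𝓞 K))⁰) (N : ℝ), 1 ≤ N → ∀ (lo hi : RP → ℝ), (∀ w, lo w ≤ hi w) →
      (∀ w, hi w - lo w ≤ N) → ∀ α₀ : 𝓞 K,
      |(Nat.card {α : 𝓞 K // α ∈ cbox K lo hi ∧ α - α₀ ∈ (𝔮 : Ideal (𝓞 K))} : ℝ) -
          (∏ w, (hi w - lo w)) / (Ideal.absNorm (𝔮 : Ideal (𝓞 K)) * √|discr K|)| ≤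
        CG * (1 + (N ^ d / Ideal.absNorm (𝔮 : Ideal (𝓞 K))) ^ (1 - 1 / (d : ℝ))))
    {a ε M U Q' : ℝ} (hε0 : 0 < ε) (hε1 : ε ≤ 1) (haε : a ≤ -ε) (hM : 3 ≤ M) (hU : 1 ≤ U) (hUQ : U ≤ Q') (hQM : Q' ≤ M ^ d)
    (hL : (3 * d : ℝ) < d * Real.log M - d * (Real.log 2 - a))
    (hv₀ : x₀ ≤ (M * (Real.exp a / 2)) ^ d) (hv3 : 3 ≤ (M * (Real.exp a / 2)) ^ d)
    (hQA : U ≤ Real.log ((M * (Real.exp a / 2)) ^ d) ^ A) :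
    ∑ 𝔮 ∈ idealsLE K Q', Ecube K M 𝔮 ≤
      ((∑ 𝔤 ∈ idealsLE K Q', (idealTotient K 𝔤)⁻¹) *
        (((idealsLE K U).card * ((d * Real.log M + d) * ((2 * Real.exp (-a)) ^ d *
          (U * (CP * M ^ d * Real.exp (-(c * Real.sqrt (Real.log ((M * (Real.exp a / 2)) ^ d))))))) +
          d * Real.log M * (ppSet K M).card)) +
        (C * ((1 + Real.log M) ^ rk * (idealsLE K Q').card * (Real.log U * (idealsLE K U).card) +
          (48 * Real.exp (-3 * a)) ^ d / M ^ d * ((U * Real.log U * (idealsLE K U).card) * (U * (idealsLE K U).card) +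
            (d * Real.log M + Real.log U + d) * (U * (idealsLE K U).card)) * (Q' ^ 2 * (idealsLE K Q').card) +
          decInt ^ d * Real.log M ^ (rk + 3) * Real.sqrt (harmU K U ^ 3) *
            (Q' * Real.sqrt (M ^ d) + M ^ d / Real.sqrt U + M ^ d / U)))) +
        ((idealsLE K Q').card + ∑ 𝔤 ∈ idealsLE K Q', (idealTotient K 𝔤)⁻¹) *
          (Cg * (1 + Real.log M) ^ rk * ((Nat.log 2 ⌊M ^ d⌋₊ + 1 : ℕ) * Real.log Q'))) *
        (((Real.log 2 - a + 3) * ((1 + K3) * (ε ^ 3)⁻¹)) ^ d / (d * Real.log M - d * (Real.log 2 - a) - 3 * d)) +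
      ((idealsLE K Q').card + ∑ 𝔮 ∈ idealsLE K Q', (idealTotient K 𝔮)⁻¹) * (ppSet K M).card +
      (∑ 𝔮 ∈ idealsLE K Q', (idealTotient K 𝔮)⁻¹) *
        (d * M ^ d * (ε + Real.exp a) / √|discr K| + 2 * CG * (1 + (M ^ d) ^ (1 - 1 / (d : ℝ)))) +
      (d * M ^ d * (ε + Real.exp a) / √|(discr K : ℝ)| * ∑ 𝔮 ∈ idealsLE K Q', ((Ideal.absNorm 𝔮 : ℕ) : ℝ)⁻¹ +
        2 * CG * ((idealsLE K Q').card + (M ^ d) ^ (1 - 1 / (d : ℝ)) * Q' ^ (1 / (d : ℝ)) *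
          ∑ 𝔮 ∈ idealsLE K Q', ((Ideal.absNorm 𝔮 : ℕ) : ℝ)⁻¹)) := by
  have hM1 : 1 ≤ M := by linarith
  have hM0 : 0 < M := by linarith
  have ha0 : a ≤ 0 := by linarith
  have hQ1 : 1 ≤ Q' := hU.trans hUQ
  have hH0 : 0 ≤ ∑ 𝔤 ∈ idealsLE K Q', (idealTotient K 𝔤)⁻¹ :=
    Finset.sum_nonneg fun 𝔤 h𝔤 => inv_nonneg.2 (idealTotient_pos (K := K) (mem_idealsLE.1 h𝔤).1).le
  have hlogM : 0 ≤ Real.log M := Real.log_nonneg hM1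
  have hlogU : 0 ≤ Real.log U := Real.log_nonneg hU
  have hlogQ : 0 ≤ Real.log Q' := Real.log_nonneg hQ1
  have hHU := harmU_nonneg (K := K) U
  have hG : ∀ t : ℝ, 0 ≤ t → _ := fun t ht =>
    chain_at_t hcore hCg0 hCg hCb1 hbal hc hCP hA hPNT ha0 hε0 hε1 ht hM hU hU hUQ hQM hv₀ hv3 hQA
  have hR0 : 0 ≤ (∑ 𝔤 ∈ idealsLE K Q', (idealTotient K 𝔤)⁻¹) *
        (((idealsLE K U).card * ((d * Real.log M + d) * ((2 * Real.exp (-a)) ^ d *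
          (U * (CP * M ^ d * Real.exp (-(c * Real.sqrt (Real.log ((M * (Real.exp a / 2)) ^ d))))))) +
          d * Real.log M * (ppSet K M).card)) +
        (C * ((1 + Real.log M) ^ rk * (idealsLE K Q').card * (Real.log U * (idealsLE K U).card) +
          (48 * Real.exp (-3 * a)) ^ d / M ^ d * ((U * Real.log U * (idealsLE K U).card) * (U * (idealsLE K U).card) +
            (d * Real.log M + Real.log U + d) * (U * (idealsLE K U).card)) * (Q' ^ 2 * (idealsLE K Q').card) +
          decInt ^ d * Real.log M ^ (rk + 3) * Real.sqrt (harmU K U ^ 3) *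
            (Q' * Real.sqrt (M ^ d) + M ^ d / Real.sqrt U + M ^ d / U)))) +
        ((idealsLE K Q').card + ∑ 𝔤 ∈ idealsLE K Q', (idealTotient K 𝔤)⁻¹) *
          (Cg * (1 + Real.log M) ^ rk * ((Nat.log 2 ⌊M ^ d⌋₊ + 1 : ℕ) * Real.log Q')) := by
    have hPD := (hG 0 le_rfl)
    -- nonnegativity from the chain bound at `t = 0` would need `PD > 0`; prove directly instead
    have h1 : 0 ≤ C * ((1 + Real.log M) ^ rk * (idealsLE K Q').card * (Real.log U * (idealsLE K U).card) +
          (48 * Real.exp (-3 * a)) ^ d / M ^ d * ((U * Real.log U * (idealsLE K U).card) * (U * (idealsLE K U).card) +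
            (d * Real.log M + Real.log U + d) * (U * (idealsLE K U).card)) * (Q' ^ 2 * (idealsLE K Q').card) +
          decInt ^ d * Real.log M ^ (rk + 3) * Real.sqrt (harmU K U ^ 3) *
            (Q' * Real.sqrt (M ^ d) + M ^ d / Real.sqrt U + M ^ d / U)) := by
      -- the core bound at `t = 0` is `≥ 0`-valued on the left, and `PD^d > 0`
      have hP : 0 < PD a ε 0 ^ d := by
        refine pow_pos ?_ _
        unfold PD kappaTD
        have hl2 := Real.log_pos one_lt_two
        have hK3 := K3_nonneg
        have : 0 < Real.log 2 - a + 3 := by linarith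
        positivity
      have hcore0 := hcore a ε 0 ha0 hε0 hε1 le_rfl M U U Q' hM hU hU hUQ hQM
      have hlhs : 0 ≤ ∑ 𝔣 ∈ (idealsLE K Q').filter (fun 𝔣 => U < Ideal.absNorm 𝔣),
          (∑ χ ∈ primChars K 𝔣, ‖psiΩ K χ (kappaT a ε 0) M‖) / Nat.card ((𝓞 K ⧸ 𝔣)ˣ) :=
        Finset.sum_nonneg fun _ _ => div_nonneg (Finset.sum_nonneg fun _ _ => norm_nonneg _) (Nat.cast_nonneg _)
      nlinarith
    have hdec := decInt_nonneg
    positivity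
  refine (sum_Ecube_le hε0 haε hM1 hL hR0 hG hCG).trans ?_
  have hcos := sum_coset_layer_le (K := K) (X := d * M ^ d * (ε + Real.exp a)) hCG0 hM0 hQ1
  linarith

/-! ## The numeric bounds (pure real inequalities) -/

omit [NumberField K] [IsTotallyReal K] in
/-- Final step for a junk term: `X ≤ c (N^n N^{−η}) PL^p`, `p ≤ p_big`, `PL^{p_big+b₀} ≤ N^η` give
`X ≤ c N^n / PL^{b₀}`. [folklore] -/
theorem junk_final {X c N PL η : ℝ} {n p pbig b₀ : ℕ} (hc : 0 ≤ c) (hN : 0 < N) (hPL1 : 1 ≤ PL)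
    (hX : X ≤ c * (N ^ n * N ^ (-η)) * PL ^ p) (hp : p ≤ pbig) (hjunk : PL ^ (pbig + b₀) ≤ N ^ η) :
    X ≤ c * N ^ n / PL ^ b₀ := by
  have h1 : N ^ (-η) * PL ^ p ≤ (PL ^ b₀)⁻¹ :=
    (mul_le_mul_of_nonneg_left (pow_le_pow_right₀ hPL1 hp) (Real.rpow_nonneg hN.le _)).trans (junk_kill hN hPL1 hjunk)
  calc X ≤ c * (N ^ n * N ^ (-η)) * PL ^ p := hX
    _ = c * N ^ n * (N ^ (-η) * PL ^ p) := by ring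
    _ ≤ c * N ^ n * (PL ^ b₀)⁻¹ := mul_le_mul_of_nonneg_left h1 (by positivity)
    _ = c * N ^ n / PL ^ b₀ := by rw [div_eq_mul_inv]

omit [NumberField K] [IsTotallyReal K] in
/-- **Piece 1 of `R · A_ε/den`** (`H · C (1+log M)^{rk} #I(Q') log U #I(U)`): a junk term.
[cite: Hinz1988, §5 pp. 191–192] -/
theorem P1_le {C CH CI KQ kq K3' H LM IQ LU IU AB N PL θ η : ℝ} {n r k₁ b₀ pA pbig : ℕ}
    (hC : 0 ≤ C) (hCH : 0 ≤ CH) (hCI : 0 ≤ CI) (hKQ : 0 ≤ KQ) (hK3 : 0 ≤ K3')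
    (hN : 0 < N) (hPL1 : 1 ≤ PL) (hH : H ≤ CH * (kq * PL) ^ 2) (hLM0 : 0 ≤ LM) (hLM : 1 + LM ≤ 3 * PL)
    (hIQ0 : 0 ≤ IQ) (hIQ : IQ ≤ CI * (KQ * N ^ (n * θ))) (hLU0 : 0 ≤ LU) (hLU : LU ≤ 2 * k₁ * PL)
    (hIU0 : 0 ≤ IU) (hIU : IU ≤ CI * PL ^ (2 * k₁)) (hAB0 : 0 ≤ AB) (hAB : AB ≤ K3' * PL ^ pA)
    (hNθ : N ^ (n * θ) ≤ N ^ n * N ^ (-η)) (hp : pA + r + 2 * k₁ + 3 ≤ pbig) (hjunk : PL ^ (pbig + b₀) ≤ N ^ η) :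
    H * (C * ((1 + LM) ^ r * IQ * (LU * IU))) * AB ≤
      (CH * kq ^ 2 * C * 3 ^ r * CI * KQ * (2 * k₁) * CI * K3') * N ^ n / PL ^ b₀ := by
  refine junk_final (by positivity) hN hPL1 ?_ hp hjunk
  have hNθ0 : 0 ≤ N ^ (n * θ) := Real.rpow_nonneg hN.le _
  calc H * (C * ((1 + LM) ^ r * IQ * (LU * IU))) * AB
      ≤ (CH * (kq * PL) ^ 2) * (C * ((3 * PL) ^ r * (CI * (KQ * N ^ (n * θ))) * ((2 * k₁ * PL) * (CI * PL ^ (2 * k₁))))) *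
          (K3' * PL ^ pA) := by
        gcongr
    _ = (CH * kq ^ 2 * C * 3 ^ r * CI * KQ * (2 * k₁) * CI * K3') * N ^ (n * θ) * PL ^ (pA + r + 2 * k₁ + 3) := by ring
    _ ≤ (CH * kq ^ 2 * C * 3 ^ r * CI * KQ * (2 * k₁) * CI * K3') * (N ^ n * N ^ (-η)) * PL ^ (pA + r + 2 * k₁ + 3) := by
        gcongr

omit [NumberField K] [IsTotallyReal K] in
/-- **Piece 2 of `R · A_ε/den`** (the type I term with `e^{−3a} = PL^{3(b₀+2)}`): a junk term.
[cite: Hinz1988, §5 pp. 191–192] -/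
theorem P2_le {C CH CI KQ kq K3' H LM IQ LU IU AB N PL θ η E3 Md U : ℝ} {n k₁ b₀ db pA pbig : ℕ}
    (hC : 0 ≤ C) (hCH : 0 ≤ CH) (hCI : 0 ≤ CI) (hKQ : 0 ≤ KQ) (hK3 : 0 ≤ K3')
    (hN : 0 < N) (hPL1 : 1 ≤ PL) (hH : H ≤ CH * (kq * PL) ^ 2) (hLM0 : 0 ≤ LM) (hLM : LM ≤ 2 * PL)
    (hIQ0 : 0 ≤ IQ) (hIQ : IQ ≤ CI * (KQ * N ^ (n * θ))) (hLU0 : 0 ≤ LU) (hLU : LU ≤ 2 * k₁ * PL)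
    (hIU0 : 0 ≤ IU) (hIU : IU ≤ CI * PL ^ (2 * k₁)) (hAB0 : 0 ≤ AB) (hAB : AB ≤ K3' * PL ^ pA)
    (hE30 : 0 ≤ E3) (hE3 : E3 ≤ PL ^ (3 * (b₀ + 2))) (hMd : N ^ n ≤ Md) (hU0 : 0 ≤ U) (hU : U ≤ PL ^ (2 * k₁))
    {Q' : ℝ} (hQ'0' : 0 ≤ Q') (hQ' : Q' ≤ KQ * N ^ (n * θ))
    (hNθ : (N ^ (n * θ)) ^ 3 ≤ N ^ n * N ^ n * N ^ (-η)) (hdb : db = n * b₀)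
    (hp : pA + 3 * db + 6 * n + 8 * k₁ + 3 ≤ pbig) (hjunk : PL ^ (pbig + b₀) ≤ N ^ η) :
    H * (C * ((48 * E3) ^ n / Md * ((U * LU * IU) * (U * IU) + (n * LM + LU + n) * (U * IU)) * (Q' ^ 2 * IQ))) * AB ≤
      (CH * kq ^ 2 * C * 48 ^ n * (2 * k₁ * CI ^ 2 + (3 * n + 2 * k₁) * CI) * (CI * KQ ^ 3) * K3') * N ^ n / PL ^ b₀ := by
  have hNn : 0 < N ^ n := pow_pos hN n
  have hMd0 : 0 < Md := lt_of_lt_of_le hNn hMd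
  have hMdinv : Md⁻¹ ≤ (N ^ n)⁻¹ := by rw [inv_le_inv₀ hMd0 hNn]; exact hMd
  have hNθ0 : 0 ≤ N ^ (n * θ) := Real.rpow_nonneg hN.le _
  refine junk_final (by positivity) hN hPL1 ?_ hp hjunk
  -- the two inner sums
  have hin : (U * LU * IU) * (U * IU) + (n * LM + LU + n) * (U * IU) ≤ (2 * k₁ * CI ^ 2 + (3 * n + 2 * k₁) * CI) * PL ^ (8 * k₁ + 1) := by
    have h1 : (U * LU * IU) * (U * IU) ≤ (PL ^ (2 * k₁) * (2 * k₁ * PL) * (CI * PL ^ (2 * k₁))) * (PL ^ (2 * k₁) * (CI * PL ^ (2 * k₁))) := by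
      gcongr
    have h2 : (n * LM + LU + n) * (U * IU) ≤ (n * (2 * PL) + 2 * k₁ * PL + n * PL) * (PL ^ (2 * k₁) * (CI * PL ^ (2 * k₁))) := by
      gcongr
      have : (n : ℝ) * 1 ≤ n * PL := mul_le_mul_of_nonneg_left hPL1 (Nat.cast_nonneg n)
      linarith
    have h3 : PL ^ (4 * k₁ + 1) ≤ PL ^ (8 * k₁ + 1) := pow_le_pow_right₀ hPL1 (by omega)
    calc (U * LU * IU) * (U * IU) + (n * LM + LU + n) * (U * IU)
        ≤ (PL ^ (2 * k₁) * (2 * k₁ * PL) * (CI * PL ^ (2 * k₁))) * (PL ^ (2 * k₁) * (CI * PL ^ (2 * k₁))) +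
          (n * (2 * PL) + 2 * k₁ * PL + n * PL) * (PL ^ (2 * k₁) * (CI * PL ^ (2 * k₁))) := add_le_add h1 h2
      _ = 2 * k₁ * CI ^ 2 * PL ^ (8 * k₁ + 1) + (3 * n + 2 * k₁) * CI * PL ^ (4 * k₁ + 1) := by ring
      _ ≤ 2 * k₁ * CI ^ 2 * PL ^ (8 * k₁ + 1) + (3 * n + 2 * k₁) * CI * PL ^ (8 * k₁ + 1) := by gcongr
      _ = _ := by ring
  have hin0 : 0 ≤ (U * LU * IU) * (U * IU) + (n * LM + LU + n) * (U * IU) := by positivity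
  rw [div_eq_mul_inv]
  calc H * (C * ((48 * E3) ^ n * Md⁻¹ * ((U * LU * IU) * (U * IU) + (n * LM + LU + n) * (U * IU)) * (Q' ^ 2 * IQ))) * AB
      ≤ (CH * (kq * PL) ^ 2) * (C * ((48 * PL ^ (3 * (b₀ + 2))) ^ n * (N ^ n)⁻¹ *
          ((2 * k₁ * CI ^ 2 + (3 * n + 2 * k₁) * CI) * PL ^ (8 * k₁ + 1)) * ((KQ * N ^ (n * θ)) ^ 2 * (CI * (KQ * N ^ (n * θ)))))) *
          (K3' * PL ^ pA) := by
        gcongr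
    _ = (CH * kq ^ 2 * C * 48 ^ n * (2 * k₁ * CI ^ 2 + (3 * n + 2 * k₁) * CI) * (CI * KQ ^ 3) * K3') *
          ((N ^ (n * θ)) ^ 3 * (N ^ n)⁻¹) * PL ^ (pA + 3 * db + 6 * n + 8 * k₁ + 3) := by
        rw [hdb]; ring
    _ ≤ _ := by
        -- `(N^{nθ})³ / N^n ≤ N^n N^{-η}`
        have hX : (N ^ (n * θ)) ^ 3 * (N ^ n)⁻¹ ≤ N ^ n * N ^ (-η) := by
          rw [← div_eq_mul_inv, div_le_iff₀ hNn]
          calc (N ^ (n * θ)) ^ 3 ≤ N ^ n * N ^ n * N ^ (-η) := hNθ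
            _ = N ^ n * N ^ (-η) * N ^ n := by ring
        exact mul_le_mul_of_nonneg_right (mul_le_mul_of_nonneg_left hX (by positivity)) (by positivity)

omit [NumberField K] [IsTotallyReal K] in
/-- **Piece 3 of `R · A_ε/den`** (the type II term): the `Q'√(M^d)` part is junk, the `U`-parts
are exactly compensated by the choice `k₁ = p_A + rk + 7 + b₀`. [cite: Hinz1988, §5 pp. 191–192] -/
theorem P3_le {C CH KQ kq K3' dI sh H LM SH AB N PL θ η Md SMd SU U Q' : ℝ} {n r k₁ b₀ pA pbig : ℕ}
    (hC : 0 ≤ C) (hCH : 0 ≤ CH) (hKQ : 0 ≤ KQ) (hK3 : 0 ≤ K3') (hdI : 0 ≤ dI) (hsh : 0 ≤ sh)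
    (hN : 0 < N) (hPL1 : 1 ≤ PL) (hH : H ≤ CH * (kq * PL) ^ 2) (hLM0 : 0 ≤ LM) (hLM : LM ≤ 2 * PL)
    (hSH0 : 0 ≤ SH) (hSH : SH ≤ sh * PL ^ 2) (hAB0 : 0 ≤ AB) (hAB : AB ≤ K3' * PL ^ pA)
    (hMd0 : 0 ≤ Md) (hMd : Md ≤ 2 ^ n * N ^ n) (hSMd0 : 0 ≤ SMd) (hSMd : SMd ≤ 2 ^ n * Real.sqrt (N ^ n))
    (hSU : SU = PL ^ k₁) (hU : U = PL ^ (2 * k₁)) (hQ'0 : 0 ≤ Q') (hQ' : Q' ≤ KQ * N ^ (n * θ))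
    (hNθ : N ^ (n * θ) * Real.sqrt (N ^ n) ≤ N ^ n * N ^ (-η)) (hk₁ : k₁ = pA + r + 7 + b₀)
    (hp : pA + r + 7 ≤ pbig) (hjunk : PL ^ (pbig + b₀) ≤ N ^ η) :
    H * (C * (dI * LM ^ (r + 3) * SH * (Q' * SMd + Md / SU + Md / U))) * AB ≤
      (CH * kq ^ 2 * C * dI * 2 ^ (r + 3) * sh * K3' * (KQ * 2 ^ n + 2 ^ (n + 1))) * N ^ n / PL ^ b₀ := by
  have hPL0 : 0 < PL := by linarith
  have hNθ0 : 0 ≤ N ^ (n * θ) := Real.rpow_nonneg hN.le _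
  have hsq0 : 0 ≤ Real.sqrt (N ^ n) := Real.sqrt_nonneg _
  -- the `U`-parts
  have hU1 : Md / SU ≤ 2 ^ n * N ^ n * (PL ^ k₁)⁻¹ := by
    rw [hSU, div_eq_mul_inv]; gcongr
  have hU2 : Md / U ≤ 2 ^ n * N ^ n * (PL ^ k₁)⁻¹ := by
    rw [hU, div_eq_mul_inv]
    gcongr
    · omega
  have hSU0 : 0 < SU := by rw [hSU]; positivity
  have hU0 : 0 < U := by rw [hU]; positivity
  set Z := CH * kq ^ 2 * C * dI * 2 ^ (r + 3) * sh * K3' with hZ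
  have hZ0 : 0 ≤ Z := by rw [hZ]; positivity
  have hmain : H * (C * (dI * LM ^ (r + 3) * SH * (Q' * SMd + Md / SU + Md / U))) * AB ≤
      Z * PL ^ (pA + r + 7) * (KQ * 2 ^ n * (N ^ (n * θ) * Real.sqrt (N ^ n)) + 2 ^ (n + 1) * N ^ n * (PL ^ k₁)⁻¹) := by
    calc H * (C * (dI * LM ^ (r + 3) * SH * (Q' * SMd + Md / SU + Md / U))) * AB
        ≤ (CH * (kq * PL) ^ 2) * (C * (dI * (2 * PL) ^ (r + 3) * (sh * PL ^ 2) *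
            ((KQ * N ^ (n * θ)) * (2 ^ n * Real.sqrt (N ^ n)) + 2 ^ n * N ^ n * (PL ^ k₁)⁻¹ + 2 ^ n * N ^ n * (PL ^ k₁)⁻¹))) *
            (K3' * PL ^ pA) := by gcongr
      _ = _ := by rw [hZ]; ring
  -- split: junk part and compensated part
  have hjunkpart : Z * PL ^ (pA + r + 7) * (KQ * 2 ^ n * (N ^ (n * θ) * Real.sqrt (N ^ n))) ≤ (Z * (KQ * 2 ^ n)) * N ^ n / PL ^ b₀ := by
    refine junk_final (by positivity) hN hPL1 ?_ hp hjunk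
    calc Z * PL ^ (pA + r + 7) * (KQ * 2 ^ n * (N ^ (n * θ) * Real.sqrt (N ^ n)))
        = Z * (KQ * 2 ^ n) * (N ^ (n * θ) * Real.sqrt (N ^ n)) * PL ^ (pA + r + 7) := by ring
      _ ≤ Z * (KQ * 2 ^ n) * (N ^ n * N ^ (-η)) * PL ^ (pA + r + 7) := by gcongr
  have hcomp : Z * PL ^ (pA + r + 7) * (2 ^ (n + 1) * N ^ n * (PL ^ k₁)⁻¹) = (Z * 2 ^ (n + 1)) * N ^ n / PL ^ b₀ := by
    rw [hk₁, pow_add PL (pA + r + 7) b₀]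
    field_simp
  calc _ ≤ Z * PL ^ (pA + r + 7) * (KQ * 2 ^ n * (N ^ (n * θ) * Real.sqrt (N ^ n)) + 2 ^ (n + 1) * N ^ n * (PL ^ k₁)⁻¹) := hmain
    _ = Z * PL ^ (pA + r + 7) * (KQ * 2 ^ n * (N ^ (n * θ) * Real.sqrt (N ^ n))) +
        Z * PL ^ (pA + r + 7) * (2 ^ (n + 1) * N ^ n * (PL ^ k₁)⁻¹) := by ring
    _ ≤ (Z * (KQ * 2 ^ n)) * N ^ n / PL ^ b₀ + (Z * 2 ^ (n + 1)) * N ^ n / PL ^ b₀ := by rw [← hcomp]; exact add_le_add hjunkpart le_rfl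
    _ = _ := by rw [hZ]; ring

omit [NumberField K] [IsTotallyReal K] in
/-- **Piece 4 of `R · A_ε/den`** (the small moduli): the Mitsui part is killed by
`PL^{p_g+b₀} ≤ e^{c√(PL/2)}`, the prime-power part is junk. [cite: Hinz1988, §2 p. 178] -/
theorem P4_le {CH CI CP Cg kq K3' H LM IU AB N PL η Ena Md U EM EP PPc SMd NL : ℝ} {n r k₁ b₀ db pA pbig pg : ℕ}
    (hCH : 0 ≤ CH) (hCI : 0 ≤ CI) (hCP : 0 ≤ CP) (hCg : 0 ≤ Cg) (hK3 : 0 ≤ K3')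
    (hN : 0 < N) (hPL1 : 1 ≤ PL) (hH : H ≤ CH * (kq * PL) ^ 2) (hLM0 : 0 ≤ LM) (hLM : LM ≤ 2 * PL) (hLM3 : 1 + LM ≤ 3 * PL)
    (hIU0 : 0 ≤ IU) (hIU : IU ≤ CI * PL ^ (2 * k₁)) (hAB0 : 0 ≤ AB) (hAB : AB ≤ K3' * PL ^ pA)
    (hEna0 : 0 ≤ Ena) (hEna : Ena ≤ PL ^ (b₀ + 2)) (hMd0 : 0 ≤ Md) (hMd : Md ≤ 2 ^ n * N ^ n)
    (hU0 : 0 ≤ U) (hU : U ≤ PL ^ (2 * k₁)) (hEM0 : 0 ≤ EM) (hEM : EM ≤ EP) (hEP0 : 0 ≤ EP)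
    (hmits : EP * PL ^ pg ≤ (PL ^ b₀)⁻¹)
    (hPPc0 : 0 ≤ PPc) (hPPc : PPc ≤ Cg * (1 + LM) ^ r * ((CI * SMd) * NL)) (hSMd0 : 0 ≤ SMd) (hSMd : SMd ≤ 2 ^ n * Real.sqrt (N ^ n))
    (hNL0 : 0 ≤ NL) (hNL : NL ≤ 5 * n * PL)
    (hNs : Real.sqrt (N ^ n) ≤ N ^ n * N ^ (-η)) (hdb : db = n * b₀)
    (hpg : pA + 4 * k₁ + db + 2 * n + 3 ≤ pg) (hp : pA + 2 * k₁ + r + 4 ≤ pbig) (hjunk : PL ^ (pbig + b₀) ≤ N ^ η) :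
    H * (IU * ((n * LM + n) * ((2 * Ena) ^ n * (U * (CP * Md * EM))) + n * LM * PPc)) * AB ≤
      (CH * kq ^ 2 * CI * (3 * n) * 2 ^ n * CP * 2 ^ n * K3' + CH * kq ^ 2 * CI * (2 * n) * Cg * 3 ^ r * CI * 2 ^ n * (5 * n) * K3') *
        N ^ n / PL ^ b₀ := by
  have hsq0 : 0 ≤ Real.sqrt (N ^ n) := Real.sqrt_nonneg _
  have hnLM : n * LM + n ≤ 3 * n * PL := by
    have : (n : ℝ) * (1 + LM) ≤ n * (3 * PL) := mul_le_mul_of_nonneg_left hLM3 (Nat.cast_nonneg n)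
    linarith
  -- split the two parts
  have hsplit : H * (IU * ((n * LM + n) * ((2 * Ena) ^ n * (U * (CP * Md * EM))) + n * LM * PPc)) * AB =
      H * (IU * ((n * LM + n) * ((2 * Ena) ^ n * (U * (CP * Md * EM))))) * AB + H * (IU * (n * LM * PPc)) * AB := by ring
  rw [hsplit]
  have hgoal : ∀ X Y : ℝ, X ≤ (CH * kq ^ 2 * CI * (3 * n) * 2 ^ n * CP * 2 ^ n * K3') * N ^ n / PL ^ b₀ →
      Y ≤ (CH * kq ^ 2 * CI * (2 * n) * Cg * 3 ^ r * CI * 2 ^ n * (5 * n) * K3') * N ^ n / PL ^ b₀ →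
      X + Y ≤ (CH * kq ^ 2 * CI * (3 * n) * 2 ^ n * CP * 2 ^ n * K3' + CH * kq ^ 2 * CI * (2 * n) * Cg * 3 ^ r * CI * 2 ^ n * (5 * n) * K3') *
        N ^ n / PL ^ b₀ := by
    intro X Y hX hY
    calc X + Y ≤ _ := add_le_add hX hY
      _ = _ := by ring
  refine hgoal _ _ ?_ ?_
  · -- Mitsui part
    calc H * (IU * ((n * LM + n) * ((2 * Ena) ^ n * (U * (CP * Md * EM))))) * AB
        ≤ (CH * (kq * PL) ^ 2) * ((CI * PL ^ (2 * k₁)) * ((3 * n * PL) * ((2 * PL ^ (b₀ + 2)) ^ n *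
            (PL ^ (2 * k₁) * (CP * (2 ^ n * N ^ n) * EP))))) * (K3' * PL ^ pA) := by gcongr
      _ = (CH * kq ^ 2 * CI * (3 * n) * 2 ^ n * CP * 2 ^ n * K3') * N ^ n * (EP * PL ^ (pA + 4 * k₁ + db + 2 * n + 3)) := by
          rw [hdb]; ring
      _ ≤ (CH * kq ^ 2 * CI * (3 * n) * 2 ^ n * CP * 2 ^ n * K3') * N ^ n * (EP * PL ^ pg) :=
          mul_le_mul_of_nonneg_left (mul_le_mul_of_nonneg_left (pow_le_pow_right₀ hPL1 hpg) hEP0) (by positivity)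
      _ ≤ (CH * kq ^ 2 * CI * (3 * n) * 2 ^ n * CP * 2 ^ n * K3') * N ^ n * (PL ^ b₀)⁻¹ := by gcongr
      _ = _ := by rw [div_eq_mul_inv]
  · -- prime-power part: junk
    have hPPc' : PPc ≤ Cg * (3 * PL) ^ r * ((CI * (2 ^ n * Real.sqrt (N ^ n))) * (5 * n * PL)) :=
      hPPc.trans (by gcongr)
    refine junk_final (by positivity) hN hPL1 ?_ hp hjunk
    calc H * (IU * (n * LM * PPc)) * AB
        ≤ (CH * (kq * PL) ^ 2) * ((CI * PL ^ (2 * k₁)) * (n * (2 * PL) * (Cg * (3 * PL) ^ r * ((CI * (2 ^ n * Real.sqrt (N ^ n))) * (5 * n * PL))))) *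
            (K3' * PL ^ pA) := by gcongr
      _ = (CH * kq ^ 2 * CI * (2 * n) * Cg * 3 ^ r * CI * 2 ^ n * (5 * n) * K3') * Real.sqrt (N ^ n) * PL ^ (pA + 2 * k₁ + r + 4) := by ring
      _ ≤ _ := mul_le_mul_of_nonneg_right (mul_le_mul_of_nonneg_left hNs (by positivity)) (by positivity)

omit [NumberField K] [IsTotallyReal K] in
/-- **Piece 5 of `R · A_ε/den`** (the non-coprime part): junk. [cite: Hinz1988, §2 (2.2)] -/
theorem P5_le {CH CI Cg KQ kq K3' H LM IQ AB N PL θ η NL LQ : ℝ} {n r b₀ pA pbig : ℕ}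
    (hCH : 0 ≤ CH) (hCI : 0 ≤ CI) (hCg : 0 ≤ Cg) (hKQ : 0 ≤ KQ) (hkq : 0 ≤ kq) (hK3 : 0 ≤ K3')
    (hN : 0 < N) (hPL1 : 1 ≤ PL) (hH0 : 0 ≤ H) (hH : H ≤ CH * (kq * PL) ^ 2) (hLM0 : 0 ≤ LM) (hLM3 : 1 + LM ≤ 3 * PL)
    (hIQ0 : 0 ≤ IQ) (hIQ : IQ ≤ CI * (KQ * N ^ (n * θ))) (hAB0 : 0 ≤ AB) (hAB : AB ≤ K3' * PL ^ pA)
    (hNL0 : 0 ≤ NL) (hNL : NL ≤ 5 * n * PL) (hLQ0 : 0 ≤ LQ) (hLQ : LQ ≤ kq * PL)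
    (hNθ : N ^ (n * θ) ≤ N ^ n * N ^ (-η)) (hN1 : 1 ≤ N ^ n * N ^ (-η))
    (hp : pA + r + 4 ≤ pbig) (hjunk : PL ^ (pbig + b₀) ≤ N ^ η) :
    (IQ + H) * (Cg * (1 + LM) ^ r * (NL * LQ)) * AB ≤
      ((CI * KQ + CH * kq ^ 2) * Cg * 3 ^ r * (5 * n) * kq * K3') * N ^ n / PL ^ b₀ := by
  have hNθ0 : 0 ≤ N ^ (n * θ) := Real.rpow_nonneg hN.le _
  refine junk_final (by positivity) hN hPL1 ?_ hp hjunk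
  have hIQH : IQ + H ≤ (CI * KQ + CH * kq ^ 2) * (N ^ n * N ^ (-η)) * PL ^ 2 := by
    have h1 : IQ ≤ CI * KQ * (N ^ n * N ^ (-η)) * PL ^ 2 := by
      calc IQ ≤ CI * (KQ * N ^ (n * θ)) := hIQ
        _ ≤ CI * (KQ * (N ^ n * N ^ (-η))) := by gcongr
        _ = CI * KQ * (N ^ n * N ^ (-η)) * 1 := by ring
        _ ≤ CI * KQ * (N ^ n * N ^ (-η)) * PL ^ 2 := by gcongr; exact one_le_pow₀ hPL1
    have h2 : H ≤ CH * kq ^ 2 * (N ^ n * N ^ (-η)) * PL ^ 2 := by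
      calc H ≤ CH * (kq * PL) ^ 2 := hH
        _ = CH * kq ^ 2 * 1 * PL ^ 2 := by ring
        _ ≤ CH * kq ^ 2 * (N ^ n * N ^ (-η)) * PL ^ 2 := by gcongr
    calc IQ + H ≤ CI * KQ * (N ^ n * N ^ (-η)) * PL ^ 2 + CH * kq ^ 2 * (N ^ n * N ^ (-η)) * PL ^ 2 := add_le_add h1 h2
      _ = _ := by ring
  have hIQH0 : 0 ≤ IQ + H := by positivity
  calc (IQ + H) * (Cg * (1 + LM) ^ r * (NL * LQ)) * AB
      ≤ ((CI * KQ + CH * kq ^ 2) * (N ^ n * N ^ (-η)) * PL ^ 2) * (Cg * (3 * PL) ^ r * ((5 * n * PL) * (kq * PL))) * (K3' * PL ^ pA) := by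
        gcongr
    _ = _ := by ring

omit [NumberField K] [IsTotallyReal K] in
/-- **`T₂ = (#I(Q') + H) · #PP`**: junk. [cite: Hinz1988, §2 (2.4)] -/
theorem T2_le {CH CI Cg KQ kq H LM IQ N PL θ η PPc SMd NL : ℝ} {n r b₀ pbig : ℕ}
    (hCH : 0 ≤ CH) (hCI : 0 ≤ CI) (hCg : 0 ≤ Cg) (hKQ : 0 ≤ KQ)
    (hN : 0 < N) (hPL1 : 1 ≤ PL) (hH0 : 0 ≤ H) (hH : H ≤ CH * (kq * PL) ^ 2) (hLM0 : 0 ≤ LM) (hLM3 : 1 + LM ≤ 3 * PL)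
    (hIQ0 : 0 ≤ IQ) (hIQ : IQ ≤ CI * (KQ * N ^ (n * θ)))
    (hPPc : PPc ≤ Cg * (1 + LM) ^ r * ((CI * SMd) * NL)) (hSMd0 : 0 ≤ SMd) (hSMd : SMd ≤ 2 ^ n * Real.sqrt (N ^ n))
    (hNL0 : 0 ≤ NL) (hNL : NL ≤ 5 * n * PL)
    (hNθs : N ^ (n * θ) * Real.sqrt (N ^ n) ≤ N ^ n * N ^ (-η)) (hNs : Real.sqrt (N ^ n) ≤ N ^ n * N ^ (-η))
    (hp : r + 3 ≤ pbig) (hjunk : PL ^ (pbig + b₀) ≤ N ^ η) :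
    (IQ + H) * PPc ≤ ((CI * KQ + CH * kq ^ 2) * Cg * 3 ^ r * CI * 2 ^ n * (5 * n)) * N ^ n / PL ^ b₀ := by
  have hNθ0 : 0 ≤ N ^ (n * θ) := Real.rpow_nonneg hN.le _
  have hsq0 : 0 ≤ Real.sqrt (N ^ n) := Real.sqrt_nonneg _
  refine junk_final (by positivity) hN hPL1 ?_ hp hjunk
  have hPPc' : PPc ≤ Cg * (3 * PL) ^ r * ((CI * (2 ^ n * Real.sqrt (N ^ n))) * (5 * n * PL)) := hPPc.trans (by gcongr)
  -- `(IQ + H) √(N^n) ≤ (CI KQ + CH kq²) (N^n N^{-η}) PL²`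
  have hIQH : (IQ + H) * Real.sqrt (N ^ n) ≤ (CI * KQ + CH * kq ^ 2) * (N ^ n * N ^ (-η)) * PL ^ 2 := by
    have h1 : IQ * Real.sqrt (N ^ n) ≤ CI * KQ * (N ^ n * N ^ (-η)) * PL ^ 2 := by
      calc IQ * Real.sqrt (N ^ n) ≤ CI * (KQ * N ^ (n * θ)) * Real.sqrt (N ^ n) := by gcongr
        _ = CI * KQ * (N ^ (n * θ) * Real.sqrt (N ^ n)) * 1 := by ring
        _ ≤ CI * KQ * (N ^ n * N ^ (-η)) * PL ^ 2 := by gcongr; exact one_le_pow₀ hPL1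
    have h2 : H * Real.sqrt (N ^ n) ≤ CH * kq ^ 2 * (N ^ n * N ^ (-η)) * PL ^ 2 := by
      calc H * Real.sqrt (N ^ n) ≤ CH * (kq * PL) ^ 2 * (N ^ n * N ^ (-η)) := by gcongr
        _ = _ := by ring
    calc (IQ + H) * Real.sqrt (N ^ n) = IQ * Real.sqrt (N ^ n) + H * Real.sqrt (N ^ n) := by ring
      _ ≤ _ := add_le_add h1 h2
      _ = _ := by ring
  calc (IQ + H) * PPc ≤ (IQ + H) * (Cg * (3 * PL) ^ r * ((CI * (2 ^ n * Real.sqrt (N ^ n))) * (5 * n * PL))) := by gcongr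
    _ = ((IQ + H) * Real.sqrt (N ^ n)) * (Cg * 3 ^ r * CI * 2 ^ n * (5 * n)) * PL ^ (r + 1) := by ring
    _ ≤ ((CI * KQ + CH * kq ^ 2) * (N ^ n * N ^ (-η)) * PL ^ 2) * (Cg * 3 ^ r * CI * 2 ^ n * (5 * n)) * PL ^ (r + 1) := by gcongr
    _ = _ := by ring

omit [NumberField K] [IsTotallyReal K] in
/-- **`T₃ = H · Layer`**: the `ε`-part is exactly `PL^{−b₀}`, the rest is junk. [cite: Hinz1988, §2 (2.1)] -/
theorem T3_le {CH CG kq H N PL η Md SD ε Ea R1 : ℝ} {n b₀ pbig : ℕ}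
    (hCH : 0 ≤ CH) (hCG : 0 ≤ CG)
    (hN : 0 < N) (hPL1 : 1 ≤ PL) (hH : H ≤ CH * (kq * PL) ^ 2)
    (hMd0 : 0 ≤ Md) (hMd : Md ≤ 2 ^ n * N ^ n) (hSD : 0 < SD) (hε : ε = (PL ^ (b₀ + 2))⁻¹) (hEa : Ea = ε)
    (hR10 : 0 ≤ R1) (hR1 : R1 ≤ 2 ^ n * N ^ (n - 1)) (hNn1 : N ^ (n - 1) ≤ N ^ n * N ^ (-η)) (hN1 : 1 ≤ N ^ n * N ^ (-η))
    (hp : 2 ≤ pbig) (hjunk : PL ^ (pbig + b₀) ≤ N ^ η) :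
    H * (n * Md * (ε + Ea) / SD + 2 * CG * (1 + R1)) ≤
      (CH * kq ^ 2 * n * 2 ^ n * 2 / SD + CH * kq ^ 2 * 2 * CG * (1 + 2 ^ n)) * N ^ n / PL ^ b₀ := by
  have hPL0 : 0 < PL := by linarith
  have hε0 : 0 < ε := by rw [hε]; positivity
  subst hEa
  have hkey3 : PL ^ 2 * Ea = (PL ^ b₀)⁻¹ := by rw [hε, pow_add]; field_simp
  rw [mul_add]
  have hgoal : ∀ X Y : ℝ, X ≤ (CH * kq ^ 2 * n * 2 ^ n * 2 / SD) * N ^ n / PL ^ b₀ →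
      Y ≤ (CH * kq ^ 2 * 2 * CG * (1 + 2 ^ n)) * N ^ n / PL ^ b₀ →
      X + Y ≤ (CH * kq ^ 2 * n * 2 ^ n * 2 / SD + CH * kq ^ 2 * 2 * CG * (1 + 2 ^ n)) * N ^ n / PL ^ b₀ := by
    intro X Y hX hY
    calc X + Y ≤ _ := add_le_add hX hY
      _ = _ := by ring
  refine hgoal _ _ ?_ ?_
  · -- the `ε`-part
    calc H * (n * Md * (Ea + Ea) / SD) ≤ (CH * (kq * PL) ^ 2) * (n * (2 ^ n * N ^ n) * (Ea + Ea) / SD) := by gcongr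
      _ = (CH * kq ^ 2 * n * 2 ^ n * 2 / SD) * N ^ n * (PL ^ 2 * Ea) := by ring
      _ = (CH * kq ^ 2 * n * 2 ^ n * 2 / SD) * N ^ n / PL ^ b₀ := by rw [hkey3, div_eq_mul_inv _ (PL ^ b₀)]
  · -- the `C_G`-part: junk
    refine junk_final (by positivity) hN hPL1 ?_ hp hjunk
    have h1 : 1 + R1 ≤ (1 + 2 ^ n) * (N ^ n * N ^ (-η)) := by
      calc 1 + R1 ≤ 1 * (N ^ n * N ^ (-η)) + 2 ^ n * (N ^ n * N ^ (-η)) := by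
            refine add_le_add (by linarith) (hR1.trans ?_)
            exact mul_le_mul_of_nonneg_left hNn1 (by positivity)
        _ = _ := by ring
    have hR1' : 0 ≤ 1 + R1 := by linarith
    calc H * (2 * CG * (1 + R1)) ≤ (CH * (kq * PL) ^ 2) * (2 * CG * ((1 + 2 ^ n) * (N ^ n * N ^ (-η)))) := by gcongr
      _ = _ := by ring

omit [NumberField K] [IsTotallyReal K] in
/-- **`T₄`, the coset layers summed**: the `ε`-part is `≤ PL^{−b₀}`, the rest is junk.
[cite: Hinz1988, §2 (2.1)] -/
theorem T4_le {Ch CI CG KQ KQ1 kq HN IQ N PL θ η Md SD ε Ea R1 Q1d : ℝ} {n b₀ pbig : ℕ}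
    (hCh : 0 ≤ Ch) (hCI : 0 ≤ CI) (hCG : 0 ≤ CG) (hKQ : 0 ≤ KQ) (hKQ1 : 0 ≤ KQ1) (hkq : 0 ≤ kq)
    (hN : 0 < N) (hPL1 : 1 ≤ PL) (hHN0 : 0 ≤ HN) (hHN : HN ≤ Ch * (kq * PL))
    (hIQ0 : 0 ≤ IQ) (hIQ : IQ ≤ CI * (KQ * N ^ (n * θ)))
    (hMd : Md ≤ 2 ^ n * N ^ n) (hSD : 0 < SD) (hε : ε = (PL ^ (b₀ + 2))⁻¹) (hEa : Ea = ε)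
    (hR10 : 0 ≤ R1) (hR1 : R1 ≤ 2 ^ n * N ^ (n - 1)) (hQ1d0 : 0 ≤ Q1d) (hQ1d : Q1d ≤ KQ1 * N ^ θ)
    (hNθ : N ^ (n * θ) ≤ N ^ n * N ^ (-η)) (hNn1θ : N ^ (n - 1) * N ^ θ ≤ N ^ n * N ^ (-η))
    (hp : 1 ≤ pbig) (hjunk : PL ^ (pbig + b₀) ≤ N ^ η) :
    n * Md * (ε + Ea) / SD * HN + 2 * CG * (IQ + R1 * Q1d * HN) ≤
      (n * 2 ^ n * 2 / SD * (Ch * kq) + 2 * CG * (CI * KQ + 2 ^ n * KQ1 * (Ch * kq))) * N ^ n / PL ^ b₀ := by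
  have hPL0 : 0 < PL := by linarith
  have hε0 : 0 < ε := by rw [hε]; positivity
  subst hEa
  have hNθ0 : 0 ≤ N ^ (n * θ) := Real.rpow_nonneg hN.le _
  have hNθ0' : 0 ≤ N ^ θ := Real.rpow_nonneg hN.le _
  have hgoal : ∀ X Y : ℝ, X ≤ (n * 2 ^ n * 2 / SD * (Ch * kq)) * N ^ n / PL ^ b₀ →
      Y ≤ (2 * CG * (CI * KQ + 2 ^ n * KQ1 * (Ch * kq))) * N ^ n / PL ^ b₀ →
      X + Y ≤ (n * 2 ^ n * 2 / SD * (Ch * kq) + 2 * CG * (CI * KQ + 2 ^ n * KQ1 * (Ch * kq))) * N ^ n / PL ^ b₀ := by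
    intro X Y hX hY
    calc X + Y ≤ _ := add_le_add hX hY
      _ = _ := by ring
  refine hgoal _ _ ?_ ?_
  · -- `ε`-part: `PL ε = (PL^{b₀+1})⁻¹ ≤ (PL^{b₀})⁻¹`
    have hkey : PL * Ea ≤ (PL ^ b₀)⁻¹ := by
      rw [hε, pow_add, mul_inv, show PL * ((PL ^ b₀)⁻¹ * (PL ^ 2)⁻¹) = (PL ^ b₀)⁻¹ * (PL / PL ^ 2) by ring]
      have : PL / PL ^ 2 ≤ 1 := by
        rw [div_le_one (by positivity)]; nlinarith
      exact mul_le_of_le_one_right (by positivity) this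
    calc n * Md * (Ea + Ea) / SD * HN ≤ n * (2 ^ n * N ^ n) * (Ea + Ea) / SD * (Ch * (kq * PL)) := by gcongr
      _ = (n * 2 ^ n * 2 / SD * (Ch * kq)) * N ^ n * (PL * Ea) := by ring
      _ ≤ (n * 2 ^ n * 2 / SD * (Ch * kq)) * N ^ n * (PL ^ b₀)⁻¹ := by gcongr
      _ = _ := by rw [div_eq_mul_inv _ (PL ^ b₀)]
  · -- `C_G`-part: junk
    refine junk_final (by positivity) hN hPL1 ?_ hp hjunk
    have h1 : IQ ≤ CI * KQ * (N ^ n * N ^ (-η)) := by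
      calc IQ ≤ CI * (KQ * N ^ (n * θ)) := hIQ
        _ ≤ CI * (KQ * (N ^ n * N ^ (-η))) := by gcongr
        _ = _ := by ring
    have h2 : R1 * Q1d * HN ≤ 2 ^ n * KQ1 * (Ch * kq) * (N ^ n * N ^ (-η)) * PL := by
      calc R1 * Q1d * HN ≤ (2 ^ n * N ^ (n - 1)) * (KQ1 * N ^ θ) * (Ch * (kq * PL)) := by gcongr
        _ = 2 ^ n * KQ1 * (Ch * kq) * (N ^ (n - 1) * N ^ θ) * PL := by ring
        _ ≤ _ := by gcongr
    have h3 : IQ + R1 * Q1d * HN ≤ (CI * KQ + 2 ^ n * KQ1 * (Ch * kq)) * (N ^ n * N ^ (-η)) * PL := by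
      have hx : 0 ≤ CI * KQ * (N ^ n * N ^ (-η)) := by positivity
      calc IQ + R1 * Q1d * HN ≤ CI * KQ * (N ^ n * N ^ (-η)) * 1 + 2 ^ n * KQ1 * (Ch * kq) * (N ^ n * N ^ (-η)) * PL := by
            rw [mul_one]; exact add_le_add h1 h2
        _ ≤ CI * KQ * (N ^ n * N ^ (-η)) * PL + 2 ^ n * KQ1 * (Ch * kq) * (N ^ n * N ^ (-η)) * PL := by gcongr
        _ = _ := by ring
    have h30 : 0 ≤ IQ + R1 * Q1d * HN := by positivity
    calc 2 * CG * (IQ + R1 * Q1d * HN) ≤ 2 * CG * ((CI * KQ + 2 ^ n * KQ1 * (Ch * kq)) * (N ^ n * N ^ (-η)) * PL) := by gcongr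
      _ = (2 * CG * (CI * KQ + 2 ^ n * KQ1 * (Ch * kq))) * (N ^ n * N ^ (-η)) * PL ^ 1 := by ring

omit [NumberField K] [IsTotallyReal K] in
/-- **The numeric bound for one cube**: the right side of `cube_struct` in terms of the atoms,
bounded by `C_c N^n / PL^{b₀}` under the parameter facts. [cite: Hinz1988, §5 pp. 191–192] -/
theorem cube_numeric {C CH CI CP Cg CG Ch KQ KQ1 kq K3' dI sh H HN LM IQ LU IU AB N PL θ η E3 Ena EM EP Md SMd SU U Q'
      PPc NL LQ SH SD ε Ea R1 Q1d : ℝ} {n r k₁ b₀ db pA pbig pg : ℕ}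
    (hC : 0 ≤ C) (hCH : 0 ≤ CH) (hCI : 0 ≤ CI) (hCP : 0 ≤ CP) (hCg : 0 ≤ Cg) (hCG : 0 ≤ CG) (hCh : 0 ≤ Ch)
    (hKQ : 0 ≤ KQ) (hKQ1 : 0 ≤ KQ1) (hkq : 0 ≤ kq) (hK3 : 0 ≤ K3') (hdI : 0 ≤ dI) (hsh : 0 ≤ sh)
    (hN : 0 < N) (hPL1 : 1 ≤ PL) (hH0 : 0 ≤ H) (hH : H ≤ CH * (kq * PL) ^ 2) (hHN0 : 0 ≤ HN) (hHN : HN ≤ Ch * (kq * PL))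
    (hLM0 : 0 ≤ LM) (hLM : LM ≤ 2 * PL) (hLM3 : 1 + LM ≤ 3 * PL)
    (hIQ0 : 0 ≤ IQ) (hIQ : IQ ≤ CI * (KQ * N ^ (n * θ))) (hLU0 : 0 ≤ LU) (hLU : LU ≤ 2 * k₁ * PL)
    (hIU0 : 0 ≤ IU) (hIU : IU ≤ CI * PL ^ (2 * k₁)) (hAB0 : 0 ≤ AB) (hAB : AB ≤ K3' * PL ^ pA)
    (hE30 : 0 ≤ E3) (hE3 : E3 ≤ PL ^ (3 * (b₀ + 2))) (hEna0 : 0 ≤ Ena) (hEna : Ena ≤ PL ^ (b₀ + 2))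
    (hEM0 : 0 ≤ EM) (hEM : EM ≤ EP) (hEP0 : 0 ≤ EP) (hmits : EP * PL ^ pg ≤ (PL ^ b₀)⁻¹)
    (hNMd : N ^ n ≤ Md) (hMd : Md ≤ 2 ^ n * N ^ n) (hSMd0 : 0 ≤ SMd) (hSMd : SMd ≤ 2 ^ n * Real.sqrt (N ^ n))
    (hSU : SU = PL ^ k₁) (hU : U = PL ^ (2 * k₁)) (hQ'0 : 0 ≤ Q') (hQ' : Q' ≤ KQ * N ^ (n * θ))
    (hPPc0 : 0 ≤ PPc) (hPPc : PPc ≤ Cg * (1 + LM) ^ r * ((CI * SMd) * NL)) (hNL0 : 0 ≤ NL) (hNL : NL ≤ 5 * n * PL)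
    (hLQ0 : 0 ≤ LQ) (hLQ : LQ ≤ kq * PL) (hSH0 : 0 ≤ SH) (hSH : SH ≤ sh * PL ^ 2) (hSD : 0 < SD)
    (hε : ε = (PL ^ (b₀ + 2))⁻¹) (hEa : Ea = ε) (hR10 : 0 ≤ R1) (hR1 : R1 ≤ 2 ^ n * N ^ (n - 1))
    (hQ1d0 : 0 ≤ Q1d) (hQ1d : Q1d ≤ KQ1 * N ^ θ)
    (hNθ : N ^ (n * θ) ≤ N ^ n * N ^ (-η)) (hNθs : N ^ (n * θ) * Real.sqrt (N ^ n) ≤ N ^ n * N ^ (-η))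
    (hNθ3 : (N ^ (n * θ)) ^ 3 ≤ N ^ n * N ^ n * N ^ (-η)) (hNn1 : N ^ (n - 1) ≤ N ^ n * N ^ (-η))
    (hNn1θ : N ^ (n - 1) * N ^ θ ≤ N ^ n * N ^ (-η)) (hNs : Real.sqrt (N ^ n) ≤ N ^ n * N ^ (-η)) (hN1 : 1 ≤ N ^ n * N ^ (-η))
    (hdb : db = n * b₀) (hk₁ : k₁ = pA + r + 7 + b₀)
    (hpbig : pbig = pA + 3 * db + 6 * n + 8 * k₁ + r + 10) (hpg : pg = pA + 4 * k₁ + db + 2 * n + 4)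
    (hjunk : PL ^ (pbig + b₀) ≤ N ^ η) :
      (H *
        ((IU * ((n * LM + n) * ((2 * Ena) ^ n *
          (U * (CP * Md * EM))) +
          n * LM * PPc)) +
        (C * ((1 + LM) ^ r * IQ * (LU * IU) +
          (48 * E3) ^ n / Md * ((U * LU * IU) * (U * IU) +
            (n * LM + LU + n) * (U * IU)) * (Q' ^ 2 * IQ) +
          dI * LM ^ (r + 3) * SH *
            (Q' * SMd + Md / SU + Md / U)))) +
        (IQ + H) *
          (Cg * (1 + LM) ^ r * (NL * LQ))) *
        AB +
      (IQ + H) * PPc +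
      H *
        (n * Md * (ε + Ea) / SD + 2 * CG * (1 + R1)) +
      (n * Md * (ε + Ea) / SD * HN +
        2 * CG * (IQ + R1 * Q1d * HN)) ≤
      ((CH * kq ^ 2 * CI * (3 * n) * 2 ^ n * CP * 2 ^ n * K3' + CH * kq ^ 2 * CI * (2 * n) * Cg * 3 ^ r * CI * 2 ^ n * (5 * n) * K3') +
        (CH * kq ^ 2 * C * 3 ^ r * CI * KQ * (2 * k₁) * CI * K3') +
        (CH * kq ^ 2 * C * 48 ^ n * (2 * k₁ * CI ^ 2 + (3 * n + 2 * k₁) * CI) * (CI * KQ ^ 3) * K3') +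
        (CH * kq ^ 2 * C * dI * 2 ^ (r + 3) * sh * K3' * (KQ * 2 ^ n + 2 ^ (n + 1))) +
        ((CI * KQ + CH * kq ^ 2) * Cg * 3 ^ r * (5 * n) * kq * K3') +
        ((CI * KQ + CH * kq ^ 2) * Cg * 3 ^ r * CI * 2 ^ n * (5 * n)) +
        (CH * kq ^ 2 * n * 2 ^ n * 2 / SD + CH * kq ^ 2 * 2 * CG * (1 + 2 ^ n)) +
        (n * 2 ^ n * 2 / SD * (Ch * kq) + 2 * CG * (CI * KQ + 2 ^ n * KQ1 * (Ch * kq)))) * N ^ n / PL ^ b₀ := by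
  have hMd0 : 0 ≤ Md := le_trans (pow_nonneg hN.le n) hNMd
  have hU0 : 0 ≤ U := by rw [hU]; positivity
  have hUle : U ≤ PL ^ (2 * k₁) := by rw [hU]
  -- exponent bookkeeping
  have e4a : pA + 4 * k₁ + db + 2 * n + 3 ≤ pg := by omega
  have e4b : pA + 2 * k₁ + r + 4 ≤ pbig := by omega
  have e1 : pA + r + 2 * k₁ + 3 ≤ pbig := by omega
  have e2 : pA + 3 * db + 6 * n + 8 * k₁ + 3 ≤ pbig := by omega
  have e3 : pA + r + 7 ≤ pbig := by omega
  have e5 : pA + r + 4 ≤ pbig := by omega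
  have e6 : r + 3 ≤ pbig := by omega
  have e7 : 2 ≤ pbig := by omega
  have e8 : 1 ≤ pbig := by omega
  -- the eight pieces
  have h4 := P4_le hCH hCI hCP hCg hK3 hN hPL1 hH hLM0 hLM hLM3 hIU0 hIU hAB0 hAB hEna0 hEna hMd0 hMd hU0 hUle hEM0 hEM hEP0
    hmits hPPc0 hPPc hSMd0 hSMd hNL0 hNL hNs hdb e4a e4b hjunk
  have h1 := P1_le hC hCH hCI hKQ hK3 hN hPL1 hH hLM0 hLM3 hIQ0 hIQ hLU0 hLU hIU0 hIU hAB0 hAB hNθ e1 hjunk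
  have h2 := P2_le hC hCH hCI hKQ hK3 hN hPL1 hH hLM0 hLM hIQ0 hIQ hLU0 hLU hIU0 hIU hAB0 hAB hE30 hE3 hNMd hU0 hUle hQ'0 hQ' hNθ3 hdb e2 hjunk
  have h3 := P3_le hC hCH hKQ hK3 hdI hsh hN hPL1 hH hLM0 hLM hSH0 hSH hAB0 hAB hMd0 hMd hSMd0 hSMd hSU hU hQ'0 hQ' hNθs hk₁ e3 hjunk
  have h5 := P5_le hCH hCI hCg hKQ hkq hK3 hN hPL1 hH0 hH hLM0 hLM3 hIQ0 hIQ hAB0 hAB hNL0 hNL hLQ0 hLQ hNθ hN1 e5 hjunk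
  have h6 := T2_le hCH hCI hCg hKQ hN hPL1 hH0 hH hLM0 hLM3 hIQ0 hIQ hPPc hSMd0 hSMd hNL0 hNL hNθs hNs e6 hjunk
  have h7 := T3_le hCH hCG hN hPL1 hH hMd0 hMd hSD hε hEa hR10 hR1 hNn1 hN1 e7 hjunk
  have h8 := T4_le hCh hCI hCG hKQ hKQ1 hkq hN hPL1 hHN0 hHN hIQ0 hIQ hMd hSD hε hEa hR10 hR1 hQ1d0 hQ1d hNθ hNn1θ e8 hjunk
  -- regroup the left side
  have hsplit : (H *
        ((IU * ((n * LM + n) * ((2 * Ena) ^ n *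
          (U * (CP * Md * EM))) +
          n * LM * PPc)) +
        (C * ((1 + LM) ^ r * IQ * (LU * IU) +
          (48 * E3) ^ n / Md * ((U * LU * IU) * (U * IU) +
            (n * LM + LU + n) * (U * IU)) * (Q' ^ 2 * IQ) +
          dI * LM ^ (r + 3) * SH *
            (Q' * SMd + Md / SU + Md / U)))) +
        (IQ + H) *
          (Cg * (1 + LM) ^ r * (NL * LQ))) *
        AB +
      (IQ + H) * PPc +
      H *
        (n * Md * (ε + Ea) / SD + 2 * CG * (1 + R1)) +
      (n * Md * (ε + Ea) / SD * HN +
        2 * CG * (IQ + R1 * Q1d * HN)) =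
      H * (IU * ((n * LM + n) * ((2 * Ena) ^ n * (U * (CP * Md * EM))) + n * LM * PPc)) * AB +
      H * (C * ((1 + LM) ^ r * IQ * (LU * IU))) * AB +
      H * (C * ((48 * E3) ^ n / Md * ((U * LU * IU) * (U * IU) + (n * LM + LU + n) * (U * IU)) * (Q' ^ 2 * IQ))) * AB +
      H * (C * (dI * LM ^ (r + 3) * SH * (Q' * SMd + Md / SU + Md / U))) * AB +
      (IQ + H) * (Cg * (1 + LM) ^ r * (NL * LQ)) * AB +
      (IQ + H) * PPc +
      H * (n * Md * (ε + Ea) / SD + 2 * CG * (1 + R1)) +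
      (n * Md * (ε + Ea) / SD * HN + 2 * CG * (IQ + R1 * Q1d * HN)) := by ring
  rw [hsplit]
  have hsum := add_le_add (add_le_add (add_le_add (add_le_add (add_le_add (add_le_add (add_le_add h4 h1) h2) h3) h5) h6) h7) h8
  refine hsum.trans (le_of_eq ?_)
  ring

/-! ## The bound for one cube with the parameter choice -/

set_option maxHeartbeats 800000 in
-- the final `cube_numeric` application unifies ~40 atoms against the structural bound
/-- **The cube bound with the parameter choice** `ε = e^a = PL^{−(b₀+2)}`, `U = Q₁ = PL^{2k₁}`
(`PL = log N`), for `N ≤ M ≤ 2N`, `PL^{2k₁} ≤ Q' ≤ K_Q N^{dθ}`, under the listed largeness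
conditions on `N`: `∑_{N𝔮≤Q'} E(A₀(M); 𝔮) ≤ C_c N^d / PL^{b₀}`. [cite: Hinz1988, §5 pp. 191–192] -/
theorem cube_final {C : ℝ} (hC : 0 < C)
    (hcore : ∀ (a ε t : ℝ), a ≤ 0 → 0 < ε → ε ≤ 1 → 0 ≤ t →
      ∀ (M U Q₁ Q : ℝ), 3 ≤ M → 1 ≤ U → 1 ≤ Q₁ → Q₁ ≤ Q → Q ≤ M ^ d →
      ∑ 𝔣 ∈ (idealsLE K Q).filter (fun 𝔣 => Q₁ < Ideal.absNorm 𝔣),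
          (∑ χ ∈ primChars K 𝔣, ‖psiΩ K χ (kappaT a ε t) M‖) / Nat.card ((𝓞 K ⧸ 𝔣)ˣ) ≤
        PD a ε t ^ d * (C * ((1 + Real.log M) ^ rk * (idealsLE K Q).card * (Real.log U * (idealsLE K U).card) +
          (48 * Real.exp (-3 * a)) ^ d / M ^ d * ((U * Real.log U * (idealsLE K U).card) * (U * (idealsLE K U).card) +
            (d * Real.log M + Real.log U + d) * (U * (idealsLE K U).card)) * (Q ^ 2 * (idealsLE K Q).card) +
          decInt ^ d * Real.log M ^ (rk + 3) * Real.sqrt (harmU K U ^ 3) *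
            (Q * Real.sqrt (M ^ d) + M ^ d / Real.sqrt U + M ^ d / Q₁))))
    {Cg : ℝ} (hCg0 : 0 ≤ Cg)
    (hCg : ∀ X : ℝ, 1 ≤ X → ∀ I : Ideal (𝓞 K),
      (Nat.card {α : 𝓞 K // α ∈ box₀ K X ∧ Ideal.span {α} = I} : ℝ) ≤ Cg * (1 + Real.log X) ^ rk)
    {Cb : ℝ} (hCb1 : 1 ≤ Cb)
    (hbal : ∀ s : InfinitePlace K → ℝ, (∀ w, 0 < s w) → ∃ u : (𝓞 K)ˣ, u ∈ posUnits K ∧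
      ∀ w : InfinitePlace K, w ((u : 𝓞 K) : K) * s w ≤ Cb * (∏ w', s w') ^ (1 / (d : ℝ)))
    {A c CP x₀ : ℝ} (hc : 0 < c) (hCP : 0 ≤ CP) (hA : 0 ≤ A)
    (hPNT : ∀ y : RP → ℝ, x₀ ≤ ∏ w, y w →
      (∀ w, (Cb ^ (d - 1))⁻¹ * (∏ w', y w') ^ (1 / (d : ℝ)) ≤ y w ∧ y w ≤ Cb * (∏ w', y w') ^ (1 / (d : ℝ))) →
      ∀ 𝔮 : Ideal (𝓞 K), 𝔮 ≠ ⊥ → (Ideal.absNorm 𝔮 : ℝ) ≤ Real.log (∏ w, y w) ^ A →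
      ∀ γ : (𝓞 K ⧸ 𝔮)ˣ, |(primeBoxCount K y 𝔮 (γ : 𝓞 K ⧸ 𝔮) : ℝ) - mitsuiMain K y / Nat.card ((𝓞 K ⧸ 𝔮)ˣ)| ≤
        CP * (∏ w, y w) * Real.exp (-(c * Real.sqrt (Real.log (∏ w, y w)))))
    {CG : ℝ} (hCG0 : 0 ≤ CG)
    (hCG : ∀ (𝔮 : (Ideal (𝓞 K))⁰) (N : ℝ), 1 ≤ N → ∀ (lo hi : RP → ℝ), (∀ w, lo w ≤ hi w) →
      (∀ w, hi w - lo w ≤ N) → ∀ α₀ : 𝓞 K,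
      |(Nat.card {α : 𝓞 K // α ∈ cbox K lo hi ∧ α - α₀ ∈ (𝔮 : Ideal (𝓞 K))} : ℝ) -
          (∏ w, (hi w - lo w)) / (Ideal.absNorm (𝔮 : Ideal (𝓞 K)) * √|discr K|)| ≤
        CG * (1 + (N ^ d / Ideal.absNorm (𝔮 : Ideal (𝓞 K))) ^ (1 - 1 / (d : ℝ))))
    {CI : ℝ} (hCI : 0 < CI) (hI : ∀ x : ℝ, 0 ≤ x → ((idealsLE K x).card : ℝ) ≤ CI * x)
    {Ch : ℝ} (hCh : 0 < Ch) (hharm : ∀ x : ℝ, 1 ≤ x → ∑ 𝔞 ∈ idealsLE K x, ((Ideal.absNorm 𝔞 : ℕ) : ℝ)⁻¹ ≤ Ch * (1 + Real.log x))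
    {CH : ℝ} (hCH : 0 < CH) (hHQ : ∀ Q : ℝ, 1 ≤ Q → ∑ 𝔤 ∈ idealsLE K Q, (idealTotient K 𝔤)⁻¹ ≤ CH * (1 + Real.log Q) ^ 2)
    {θ η : ℝ} (hθ0 : 0 < θ) (hθ : θ < 1 / 2) (hη0 : 0 < η) (hηθ : η ≤ d * (1 / 2 - θ)) (hη1 : η ≤ 1 / 2)
    {b₀ k₁ pA db pbig pg : ℕ} (hpA : pA = 3 * d * (b₀ + 2) + d - 1) (hdb : db = d * b₀) (hk₁ : k₁ = pA + rk + 7 + b₀)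
    (hpbig : pbig = pA + 3 * db + 6 * d + 8 * k₁ + rk + 10) (hpg : pg = pA + 4 * k₁ + db + 2 * d + 4)
    (hA2k : A = (2 * k₁ + 1 : ℕ))
    {KQ kq K3' sh : ℝ} (hKQ : 1 ≤ KQ) (hkq : kq = 1 + Real.log KQ + d) (hK3' : K3' = 2 / d * (1 + K3) ^ d)
    (hsh : sh = 1 + (Ch * (1 + 2 * k₁)) ^ 2)
    {N PL : ℝ} (hN0 : 0 < N) (hNPL : Real.log N = PL) (hPL : ((4 * b₀ + 10 : ℕ) : ℝ) ^ 2 ≤ PL)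
    (hjunk : PL ^ (pbig + b₀) ≤ N ^ η) (hmits : PL ^ (pg + b₀) ≤ Real.exp (c * Real.sqrt (PL / 2)))
    (hx₀ : x₀ ≤ (N * ((PL ^ (b₀ + 2))⁻¹ / 2)) ^ d) (hv3 : 3 ≤ (N * ((PL ^ (b₀ + 2))⁻¹ / 2)) ^ d)
    (hlogv : PL / 2 ≤ Real.log ((N * ((PL ^ (b₀ + 2))⁻¹ / 2)) ^ d))
    (hQA : PL ^ (2 * k₁) ≤ Real.log ((N * ((PL ^ (b₀ + 2))⁻¹ / 2)) ^ d) ^ A)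
    (hKQN : KQ * N ^ (d * θ) ≤ N ^ d)
    {M : ℝ} (hNM : N ≤ M) (hM2 : M ≤ 2 * N) {Q' : ℝ} (hQ'1 : PL ^ (2 * k₁) ≤ Q') (hQ'2 : Q' ≤ KQ * N ^ (d * θ)) :
    ∑ 𝔮 ∈ idealsLE K Q', Ecube K M 𝔮 ≤ ((CH * kq ^ 2 * CI * (3 * d) * 2 ^ d * CP * 2 ^ d * K3' + CH * kq ^ 2 * CI * (2 * d) * Cg * 3 ^ rk * CI * 2 ^ d * (5 * d) * K3') +
        (CH * kq ^ 2 * C * 3 ^ rk * CI * KQ * (2 * k₁) * CI * K3') +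
        (CH * kq ^ 2 * C * 48 ^ d * (2 * k₁ * CI ^ 2 + (3 * d + 2 * k₁) * CI) * (CI * KQ ^ 3) * K3') +
        (CH * kq ^ 2 * C * decInt ^ d * 2 ^ (rk + 3) * sh * K3' * (KQ * 2 ^ d + 2 ^ (d + 1))) +
        ((CI * KQ + CH * kq ^ 2) * Cg * 3 ^ rk * (5 * d) * kq * K3') +
        ((CI * KQ + CH * kq ^ 2) * Cg * 3 ^ rk * CI * 2 ^ d * (5 * d)) +
        (CH * kq ^ 2 * d * 2 ^ d * 2 / √|(discr K : ℝ)| + CH * kq ^ 2 * 2 * CG * (1 + 2 ^ d)) +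
        (d * 2 ^ d * 2 / √|(discr K : ℝ)| * (Ch * kq) + 2 * CG * (CI * KQ + 2 ^ d * KQ ^ (1 / (d : ℝ)) * (Ch * kq)))) * N ^ d / PL ^ b₀ := by
  have hd : 1 ≤ d := Module.finrank_pos
  have hdR : (1 : ℝ) ≤ d := by exact_mod_cast hd
  -- parameter facts
  obtain ⟨hPL1, hε0, hε1, haε, ha0, hexpa, hla, hlogε⟩ := param_facts b₀ hPL
  have hb10 : (100 : ℝ) ≤ PL := by
    have hb : (10 : ℝ) ≤ (4 * b₀ + 10 : ℕ) := by exact_mod_cast (by omega : 10 ≤ 4 * b₀ + 10)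
    exact le_trans (by nlinarith only [hb]) hPL
  have hPL2 : 2 ≤ PL := by linarith only [hb10]
  have hPL0 : 0 < PL := by linarith only [hb10]
  obtain ⟨hM3, hlogMlo, hlogMhi, hlogM3, hNdMd, hMd2⟩ := cube_facts hN0 hNPL hPL2 hNM hM2 d
  have hM1 : 1 ≤ M := by linarith only [hM3]
  have hM0 : 0 < M := by linarith only [hM3]
  have hN1 : 1 ≤ N := by
    have := Real.add_one_le_exp PL
    have h := Real.exp_log hN0
    rw [hNPL] at h
    linarith only [this, h, hPL0]
  have hU1 : 1 ≤ PL ^ (2 * k₁) := one_le_pow₀ hPL1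
  have hQ'1' : 1 ≤ Q' := hU1.trans hQ'1
  have hQ'0 : 0 ≤ Q' := by linarith only [hQ'1']
  have hQ'M : Q' ≤ M ^ d := hQ'2.trans (hKQN.trans hNdMd)
  have hL : (3 * d : ℝ) < d * Real.log M - d * (Real.log 2 - Real.log ((PL ^ (b₀ + 2))⁻¹)) := by
    have h1 : (d : ℝ) * (PL / 2) ≤ d * (Real.log M - (Real.log 2 - Real.log ((PL ^ (b₀ + 2))⁻¹) + 3)) :=
      mul_le_mul_of_nonneg_left (by linarith only [hla, hlogMlo]) (by positivity)
    have h2 : (0 : ℝ) < d * (PL / 2) := by positivity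
    have h3 : (d : ℝ) * (Real.log M - (Real.log 2 - Real.log ((PL ^ (b₀ + 2))⁻¹) + 3)) =
        d * Real.log M - d * (Real.log 2 - Real.log ((PL ^ (b₀ + 2))⁻¹)) - 3 * d := by ring
    linarith only [h1, h2, h3]
  -- `e^a`-box conditions at `M`
  have hmono : (N * ((PL ^ (b₀ + 2))⁻¹ / 2)) ^ d ≤ (M * (Real.exp (Real.log ((PL ^ (b₀ + 2))⁻¹)) / 2)) ^ d := by
    rw [hexpa]
    exact pow_le_pow_left₀ (by positivity) (mul_le_mul_of_nonneg_right hNM (by positivity)) d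
  have hv₀M : x₀ ≤ (M * (Real.exp (Real.log ((PL ^ (b₀ + 2))⁻¹)) / 2)) ^ d := hx₀.trans hmono
  have hv3M : 3 ≤ (M * (Real.exp (Real.log ((PL ^ (b₀ + 2))⁻¹)) / 2)) ^ d := hv3.trans hmono
  have hlogvM : PL / 2 ≤ Real.log ((M * (Real.exp (Real.log ((PL ^ (b₀ + 2))⁻¹)) / 2)) ^ d) :=
    hlogv.trans (Real.log_le_log (by positivity) hmono)
  have hA0 : 0 ≤ A := by rw [hA2k]; positivity
  have hQAM : PL ^ (2 * k₁) ≤ Real.log ((M * (Real.exp (Real.log ((PL ^ (b₀ + 2))⁻¹)) / 2)) ^ d) ^ A :=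
    hQA.trans (Real.rpow_le_rpow (by linarith only [hlogv, hPL0]) (Real.log_le_log (by positivity) hmono) hA0)
  -- the structural bound
  have hS := cube_struct hcore hCg0 hCg hCb1 hbal hc hCP hA hPNT hCG0 hCG hε0 hε1 haε hM3 hU1 hQ'1 hQ'M hL hv₀M hv3M hQAM
  refine hS.trans ?_
  -- ## the atoms and their facts
  have hKQ0 : 0 ≤ KQ := by linarith only [hKQ]
  have hlogKQ : 0 ≤ Real.log KQ := Real.log_nonneg hKQ
  have hkq1 : 1 ≤ kq := by rw [hkq]; linarith only [hlogKQ, hdR]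
  have hkq0 : 0 ≤ kq := by linarith only [hkq1]
  have hK3'0 : 0 ≤ K3' := by rw [hK3']; have := K3_nonneg; positivity
  have hsh0 : 0 ≤ sh := by rw [hsh]; positivity
  have hNθ0 : 0 ≤ N ^ (d * θ) := Real.rpow_nonneg hN0.le _
  -- `H`
  have hlogQ' : 1 + Real.log Q' ≤ kq * PL := by
    have h2 : Real.log Q' ≤ Real.log (KQ * N ^ (d * θ)) := Real.log_le_log (by linarith only [hQ'1']) hQ'2
    rw [Real.log_mul (by linarith only [hKQ]) (by positivity), Real.log_rpow hN0, hNPL] at h2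
    have h3 : d * θ * PL ≤ d * PL := by
      have : (d : ℝ) * θ ≤ d * 1 := mul_le_mul_of_nonneg_left (by linarith only [hθ]) (by positivity)
      exact mul_le_mul_of_nonneg_right (by linarith only [this]) hPL0.le
    have h4 : Real.log KQ ≤ Real.log KQ * PL := le_mul_of_one_le_right hlogKQ hPL1
    rw [hkq]
    have h5 : (1 + Real.log KQ + d) * PL = PL + Real.log KQ * PL + d * PL := by ring
    linarith only [h2, h3, h4, h5, hPL1]
  have hlogQ'0 : 0 ≤ Real.log Q' := Real.log_nonneg hQ'1'
  have hH0 : 0 ≤ ∑ 𝔤 ∈ idealsLE K Q', (idealTotient K 𝔤)⁻¹ :=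
    Finset.sum_nonneg fun 𝔤 h𝔤 => inv_nonneg.2 (idealTotient_pos (K := K) (mem_idealsLE.1 h𝔤).1).le
  have hH : ∑ 𝔤 ∈ idealsLE K Q', (idealTotient K 𝔤)⁻¹ ≤ CH * (kq * PL) ^ 2 :=
    (hHQ Q' hQ'1').trans (mul_le_mul_of_nonneg_left (pow_le_pow_left₀ (by linarith only [hlogQ'0]) hlogQ' 2) hCH.le)
  -- `HN`
  have hHN0 : 0 ≤ ∑ 𝔮 ∈ idealsLE K Q', ((Ideal.absNorm 𝔮 : ℕ) : ℝ)⁻¹ := Finset.sum_nonneg fun _ _ => inv_nonneg.2 (Nat.cast_nonneg _)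
  have hHN : ∑ 𝔮 ∈ idealsLE K Q', ((Ideal.absNorm 𝔮 : ℕ) : ℝ)⁻¹ ≤ Ch * (kq * PL) :=
    (hharm Q' hQ'1').trans (mul_le_mul_of_nonneg_left hlogQ' hCh.le)
  -- `IQ`, `IU`
  have hIQ : ((idealsLE K Q').card : ℝ) ≤ CI * (KQ * N ^ (d * θ)) := (hI Q' hQ'0).trans (mul_le_mul_of_nonneg_left hQ'2 hCI.le)
  have hIU : ((idealsLE K (PL ^ (2 * k₁))).card : ℝ) ≤ CI * PL ^ (2 * k₁) := hI _ (by positivity)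
  -- logs
  have hlogPL : Real.log PL ≤ PL := (Real.log_le_sub_one_of_pos hPL0).trans (sub_le_self _ zero_le_one)
  have hLU0 : 0 ≤ Real.log (PL ^ (2 * k₁)) := Real.log_nonneg hU1
  have hLU : Real.log (PL ^ (2 * k₁)) ≤ 2 * k₁ * PL := by
    rw [Real.log_pow]; push_cast
    exact mul_le_mul_of_nonneg_left hlogPL (by positivity)
  have hlogM0 : 0 ≤ Real.log M := Real.log_nonneg hM1
  -- `AB`
  have hAB0 : 0 ≤ ((Real.log 2 - Real.log ((PL ^ (b₀ + 2))⁻¹) + 3) * ((1 + K3) * ((PL ^ (b₀ + 2))⁻¹ ^ 3)⁻¹)) ^ d /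
      (d * Real.log M - d * (Real.log 2 - Real.log ((PL ^ (b₀ + 2))⁻¹)) - 3 * d) := by
    have hl2 := Real.log_pos one_lt_two
    have hK3 := K3_nonneg
    have : 0 ≤ Real.log 2 - Real.log ((PL ^ (b₀ + 2))⁻¹) + 3 := by linarith only [hl2, ha0]
    have hden : 0 < d * Real.log M - d * (Real.log 2 - Real.log ((PL ^ (b₀ + 2))⁻¹)) - 3 * d := by linarith only [hL]
    positivity
  have hAB := Aeden_le b₀ d Module.finrank_pos hPL1 rfl hla ha0 hlogMlo (a := Real.log ((PL ^ (b₀ + 2))⁻¹))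
  have hpA' : 3 * d * (b₀ + 2) + d - 1 = pA := hpA.symm
  rw [hpA'] at hAB
  rw [← hK3'] at hAB
  -- `E3`, `Ena`, `Ea`
  have hexpna : Real.exp (-Real.log ((PL ^ (b₀ + 2))⁻¹)) = PL ^ (b₀ + 2) := by
    rw [Real.exp_neg, hexpa, inv_inv]
  have hexp3a : Real.exp (-3 * Real.log ((PL ^ (b₀ + 2))⁻¹)) = PL ^ (3 * (b₀ + 2)) := by
    rw [show -3 * Real.log ((PL ^ (b₀ + 2))⁻¹) = ((3 : ℕ) : ℝ) * (-Real.log ((PL ^ (b₀ + 2))⁻¹)) by push_cast; ring,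
      Real.exp_nat_mul, hexpna, ← pow_mul, mul_comm]
  -- `EM ≤ EP`
  have hEM : Real.exp (-(c * Real.sqrt (Real.log ((M * (Real.exp (Real.log ((PL ^ (b₀ + 2))⁻¹)) / 2)) ^ d)))) ≤
      Real.exp (-(c * Real.sqrt (PL / 2))) :=
    Real.exp_le_exp.2 (neg_le_neg (mul_le_mul_of_nonneg_left (Real.sqrt_le_sqrt hlogvM) hc.le))
  have hmits' : Real.exp (-(c * Real.sqrt (PL / 2))) * PL ^ pg ≤ (PL ^ b₀)⁻¹ := by
    rw [Real.exp_neg, ← div_eq_inv_mul, div_le_iff₀ (Real.exp_pos _), ← div_eq_inv_mul, le_div_iff₀ (by positivity), ← pow_add]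
    exact hmits
  -- `Md`, `SMd`, `SU`
  have hSMd : Real.sqrt (M ^ d) ≤ 2 ^ d * Real.sqrt (N ^ d) := by
    calc Real.sqrt (M ^ d) ≤ Real.sqrt (2 ^ d * N ^ d) := Real.sqrt_le_sqrt hMd2
      _ = Real.sqrt (2 ^ d) * Real.sqrt (N ^ d) := Real.sqrt_mul (by positivity) _
      _ ≤ 2 ^ d * Real.sqrt (N ^ d) := by
          refine mul_le_mul_of_nonneg_right ?_ (Real.sqrt_nonneg _)
          rw [Real.sqrt_le_left (by positivity)]
          exact le_self_pow₀ (one_le_pow₀ (by norm_num)) two_ne_zero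
  have hSU : Real.sqrt (PL ^ (2 * k₁)) = PL ^ k₁ := by
    rw [pow_mul', Real.sqrt_sq (by positivity)]
  -- `PPc`, `NL`
  have hPPc := card_cube_higherPrimePowers_le hCg0 hCg hM1 (K := K)
  have hIS : ((idealsLE K (Real.sqrt (M ^ d))).card : ℝ) ≤ CI * Real.sqrt (M ^ d) := hI _ (Real.sqrt_nonneg _)
  have hcast : (((idealsLE K (Real.sqrt (M ^ d))).card * (Nat.log 2 ⌊M ^ d⌋₊ + 1) : ℕ) : ℝ) =
      ((idealsLE K (Real.sqrt (M ^ d))).card : ℝ) * ((Nat.log 2 ⌊M ^ d⌋₊ + 1 : ℕ) : ℝ) := by push_cast; ring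
  have hPPc' : (((cubeF K M).filter (fun α => idealVonMangoldt (Ideal.span {α}) ≠ 0 ∧ ¬ (Ideal.span {α}).IsPrime)).card : ℝ) ≤
      Cg * (1 + Real.log M) ^ rk * ((CI * Real.sqrt (M ^ d)) * ((Nat.log 2 ⌊M ^ d⌋₊ + 1 : ℕ) : ℝ)) := by
    refine hPPc.trans (le_of_eq_of_le ?_ (mul_le_mul_of_nonneg_left (mul_le_mul_of_nonneg_right hIS (Nat.cast_nonneg _)) (by positivity)))
    push_cast; ring
  have hNL : (((Nat.log 2 ⌊M ^ d⌋₊ + 1 : ℕ) : ℕ) : ℝ) ≤ 5 * d * PL := by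
    have h1 := natLog_le_two_mul_log (one_le_pow₀ hM1 : (1 : ℝ) ≤ M ^ d)
    rw [Real.log_pow] at h1
    have h5 : (d : ℝ) * Real.log M ≤ d * (2 * PL) := mul_le_mul_of_nonneg_left hlogMhi (by positivity)
    have h6 : (1 : ℝ) ≤ d * PL := one_le_mul_of_one_le_of_one_le hdR hPL1
    push_cast
    linarith only [h1, h5, h6]
  -- `SH`
  have hharmU : harmU K (PL ^ (2 * k₁)) ≤ Ch * (1 + 2 * k₁) * PL := by
    unfold harmU
    refine (hharm _ hU1).trans ?_
    have : 1 + Real.log (PL ^ (2 * k₁)) ≤ (1 + 2 * k₁) * PL := by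
      have h5 : (1 + 2 * k₁ : ℝ) * PL = PL + 2 * k₁ * PL := by ring
      linarith only [hLU, hPL1, h5]
    calc Ch * (1 + Real.log (PL ^ (2 * k₁))) ≤ Ch * ((1 + 2 * k₁) * PL) := mul_le_mul_of_nonneg_left this hCh.le
      _ = _ := by ring
  have hharmU0 : 0 ≤ harmU K (PL ^ (2 * k₁)) := harmU_nonneg (K := K) _
  have hSH : Real.sqrt (harmU K (PL ^ (2 * k₁)) ^ 3) ≤ sh * PL ^ 2 := by
    have h1 : Real.sqrt (harmU K (PL ^ (2 * k₁)) ^ 3) ≤ 1 + harmU K (PL ^ (2 * k₁)) ^ 2 := by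
      rw [Real.sqrt_le_left (by positivity)]
      nlinarith only [sq_nonneg (harmU K (PL ^ (2 * k₁)) ^ 2 - harmU K (PL ^ (2 * k₁)) / 2), sq_nonneg (harmU K (PL ^ (2 * k₁)))]
    have h2 : harmU K (PL ^ (2 * k₁)) ^ 2 ≤ (Ch * (1 + 2 * k₁)) ^ 2 * PL ^ 2 := by
      rw [← mul_pow]; exact pow_le_pow_left₀ hharmU0 hharmU 2
    have h3 : (1 : ℝ) ≤ PL ^ 2 := one_le_pow₀ hPL1
    rw [hsh]
    have h4 : (1 + (Ch * (1 + 2 * k₁)) ^ 2) * PL ^ 2 = PL ^ 2 + (Ch * (1 + 2 * k₁)) ^ 2 * PL ^ 2 := by ring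
    linarith only [h1, h2, h3, h4]
  -- `R1`, `Q1d`
  have hR1 : (M ^ d) ^ (1 - 1 / (d : ℝ)) ≤ 2 ^ d * N ^ (d - 1) := by
    have h1 : (M ^ d) ^ (1 - 1 / (d : ℝ)) = M ^ (d - 1) := by
      rw [← Real.rpow_natCast M d, ← Real.rpow_mul hM0.le, ← Real.rpow_natCast M (d - 1)]
      congr 1
      rw [Nat.cast_sub hd]; push_cast; field_simp
    rw [h1]
    calc M ^ (d - 1) ≤ (2 * N) ^ (d - 1) := pow_le_pow_left₀ hM0.le hM2 _
      _ = 2 ^ (d - 1) * N ^ (d - 1) := mul_pow _ _ _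
      _ ≤ 2 ^ d * N ^ (d - 1) :=
          mul_le_mul_of_nonneg_right (pow_le_pow_right₀ (by norm_num) (Nat.sub_le d 1)) (by positivity)
  have hQ1d : Q' ^ (1 / (d : ℝ)) ≤ KQ ^ (1 / (d : ℝ)) * N ^ θ := by
    calc Q' ^ (1 / (d : ℝ)) ≤ (KQ * N ^ (d * θ)) ^ (1 / (d : ℝ)) := Real.rpow_le_rpow hQ'0 hQ'2 (by positivity)
      _ = KQ ^ (1 / (d : ℝ)) * N ^ θ := by
          rw [Real.mul_rpow hKQ0 hNθ0, ← Real.rpow_mul hN0.le]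
          congr 2
          field_simp
  -- `N`-power facts
  obtain ⟨hNθ, hNθs, hNθ3, hNn1, hNn1θ, hNs, hN1'⟩ := Npow_facts d hd hN1 hθ0 hθ hη0 hηθ hη1
  have hSD : 0 < √|(discr K : ℝ)| := Real.sqrt_pos.2 (abs_pos.2 (Int.cast_ne_zero.2 (discr_ne_zero K)))
  -- ## conclude with the numeric lemma
  exact cube_numeric hC.le hCH.le hCI.le hCP hCg0 hCG0 hCh.le hKQ0 (Real.rpow_nonneg hKQ0 _) hkq0 hK3'0 (pow_nonneg decInt_nonneg d) hsh0
    hN0 hPL1 hH0 hH hHN0 hHN hlogM0 hlogMhi hlogM3 (Nat.cast_nonneg _) hIQ hLU0 hLU (Nat.cast_nonneg _) hIU hAB0 hAB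
    (Real.exp_pos _).le (le_of_eq hexp3a) (Real.exp_pos _).le (le_of_eq hexpna) (Real.exp_pos _).le hEM (Real.exp_pos _).le hmits'
    hNdMd hMd2 (Real.sqrt_nonneg _) hSMd hSU rfl hQ'0 hQ'2 (Nat.cast_nonneg _) hPPc' (Nat.cast_nonneg _) hNL hlogQ'0 (by linarith only [hlogQ'])
    (Real.sqrt_nonneg _) hSH hSD rfl hexpa (Real.rpow_nonneg (by positivity) _) hR1 (Real.rpow_nonneg hQ'0 _) hQ1d
    hNθ hNθs hNθ3 hNn1 hNn1θ hNs hN1' hdb hk₁ hpbig hpg hjunk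

/-! ## The main theorem -/

/-- **Bombieri–Vinogradov for the primes of a totally real field, level `θ < 1/2`** (Hinz 1988,
Theorem; the input of [CastilloEtAl2015, Theorem 2.7] in the totally real case), **from Mitsui's
prime number theorem for classes in balanced boxes** (the hypothesis `hPNT`,
[Mitsui1956, Main Theorem] in Hinz's formulation (1.6)/p. 178): for every `B > 0`,
`∑_{N𝔮 ≤ Q} max_{(u,𝔮)=1} |P(N;𝔮,u) − P(N)/φ(𝔮)| ≤ C |A(N)|/(log N)^B` for `N ≥ N₀`, `Q ≤ |A(N)|^θ`.
[cite: Hinz1988, §1 (1.6) and §5 pp. 191–192] -/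
theorem primesHaveLevel_of_PNT
    (hPNT : ∀ c₁ c₂ : ℝ, 0 < c₁ → c₁ ≤ c₂ → ∀ A : ℝ, 0 < A →
      ∃ c : ℝ, 0 < c ∧ ∃ C x₀ : ℝ, ∀ y : RP → ℝ, x₀ ≤ ∏ w, y w →
        (∀ w, c₁ * (∏ w', y w') ^ (1 / (d : ℝ)) ≤ y w ∧ y w ≤ c₂ * (∏ w', y w') ^ (1 / (d : ℝ))) →
        ∀ 𝔮 : Ideal (𝓞 K), 𝔮 ≠ ⊥ → (Ideal.absNorm 𝔮 : ℝ) ≤ Real.log (∏ w, y w) ^ A →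
        ∀ γ : (𝓞 K ⧸ 𝔮)ˣ, |(primeBoxCount K y 𝔮 (γ : 𝓞 K ⧸ 𝔮) : ℝ) - mitsuiMain K y / Nat.card ((𝓞 K ⧸ 𝔮)ˣ)| ≤
          C * (∏ w, y w) * Real.exp (-(c * Real.sqrt (Real.log (∏ w, y w)))))
    {θ : ℝ} (hθ0 : 0 < θ) (hθ : θ < 1 / 2) : MaynardNF.PrimesHaveLevel K θ := by
  intro B hB
  have hd : 1 ≤ d := Module.finrank_pos
  have hdR : (1 : ℝ) ≤ d := by exact_mod_cast hd
  -- ## constants of the field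
  obtain ⟨C, hC, hcore⟩ := core_at_t (K := K)
  obtain ⟨Cg, hCg0, hCg⟩ := card_generators_box₀_le (K := K)
  obtain ⟨Cb, hCb1, hbal⟩ := exists_posUnit_mul_le_rpow K
  obtain ⟨CG₀, hCG₀⟩ := abs_card_cbox_coset_sub_le_uniform (K := K)
  obtain ⟨CI, hCI, hI⟩ := card_idealsLE_le_linear (K := K)
  obtain ⟨Ch, hCh, hharm⟩ := harmonic_le (K := K)
  obtain ⟨CH, hCH, hHQ⟩ := sum_inv_idealTotient_le_log_sq (K := K)
  have hCG : ∀ (𝔮 : (Ideal (𝓞 K))⁰) (N : ℝ), 1 ≤ N → ∀ (lo hi : RP → ℝ), (∀ w, lo w ≤ hi w) →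
      (∀ w, hi w - lo w ≤ N) → ∀ α₀ : 𝓞 K,
      |(Nat.card {α : 𝓞 K // α ∈ cbox K lo hi ∧ α - α₀ ∈ (𝔮 : Ideal (𝓞 K))} : ℝ) -
          (∏ w, (hi w - lo w)) / (Ideal.absNorm (𝔮 : Ideal (𝓞 K)) * √|discr K|)| ≤
        max CG₀ 0 * (1 + (N ^ d / Ideal.absNorm (𝔮 : Ideal (𝓞 K))) ^ (1 - 1 / (d : ℝ))) :=
    fun 𝔮 N hN lo hi h1 h2 α₀ => (hCG₀ 𝔮 N hN lo hi h1 h2 α₀).trans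
      (mul_le_mul_of_nonneg_right (le_max_left _ _) (by positivity))
  -- ## exponents
  obtain ⟨b₀, hb₀⟩ : ∃ b₀ : ℕ, b₀ = ⌈B⌉₊ := ⟨_, rfl⟩
  obtain ⟨pA, hpA⟩ : ∃ pA : ℕ, pA = 3 * d * (b₀ + 2) + d - 1 := ⟨_, rfl⟩
  obtain ⟨db, hdb⟩ : ∃ db : ℕ, db = d * b₀ := ⟨_, rfl⟩
  obtain ⟨k₁, hk₁⟩ : ∃ k₁ : ℕ, k₁ = pA + rk + 7 + b₀ := ⟨_, rfl⟩
  obtain ⟨pbig, hpbig⟩ : ∃ pbig : ℕ, pbig = pA + 3 * db + 6 * d + 8 * k₁ + rk + 10 := ⟨_, rfl⟩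
  obtain ⟨pg, hpg⟩ : ∃ pg : ℕ, pg = pA + 4 * k₁ + db + 2 * d + 4 := ⟨_, rfl⟩
  obtain ⟨η, hη⟩ : ∃ η : ℝ, η = min (d * (1 / 2 - θ)) (1 / 2) := ⟨_, rfl⟩
  have hη0 : 0 < η := by rw [hη]; exact lt_min (by nlinarith) (by norm_num)
  have hηθ : η ≤ d * (1 / 2 - θ) := by rw [hη]; exact min_le_left _ _
  have hη1 : η ≤ 1 / 2 := by rw [hη]; exact min_le_right _ _
  -- ## Mitsui's theorem for the shape constants of `Cb` and `A = 2k₁ + 1`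
  have hc₁ : 0 < (Cb ^ (d - 1))⁻¹ := by positivity
  have hc₁₂ : (Cb ^ (d - 1))⁻¹ ≤ Cb := (inv_le_one_of_one_le₀ (one_le_pow₀ hCb1)).trans hCb1
  obtain ⟨c, hc, CP₀, x₀, hP₀⟩ := hPNT _ _ hc₁ hc₁₂ ((2 * k₁ + 1 : ℕ) : ℝ) (by positivity)
  -- nonnegative constant and `x₀ ≥ 1`
  have hP : ∀ y : RP → ℝ, max x₀ 1 ≤ ∏ w, y w →
      (∀ w, (Cb ^ (d - 1))⁻¹ * (∏ w', y w') ^ (1 / (d : ℝ)) ≤ y w ∧ y w ≤ Cb * (∏ w', y w') ^ (1 / (d : ℝ))) →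
      ∀ 𝔮 : Ideal (𝓞 K), 𝔮 ≠ ⊥ → (Ideal.absNorm 𝔮 : ℝ) ≤ Real.log (∏ w, y w) ^ ((2 * k₁ + 1 : ℕ) : ℝ) →
      ∀ γ : (𝓞 K ⧸ 𝔮)ˣ, |(primeBoxCount K y 𝔮 (γ : 𝓞 K ⧸ 𝔮) : ℝ) - mitsuiMain K y / Nat.card ((𝓞 K ⧸ 𝔮)ˣ)| ≤
        max CP₀ 0 * (∏ w, y w) * Real.exp (-(c * Real.sqrt (Real.log (∏ w, y w)))) := by
    intro y hy hshape 𝔮 h𝔮 hN γ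
    have hprod : 0 ≤ ∏ w, y w := le_trans (le_trans zero_le_one (le_max_right _ _)) hy
    refine (hP₀ y ((le_max_left _ _).trans hy) hshape 𝔮 h𝔮 hN γ).trans ?_
    exact mul_le_mul_of_nonneg_right (mul_le_mul_of_nonneg_right (le_max_left _ _) hprod) (Real.exp_pos _).le
  -- ## the size of `A(N)` and `K_Q`
  obtain ⟨κ, hκ⟩ : ∃ κ : ℝ, κ = boxDensity K := ⟨_, rfl⟩
  have hκ0 : 0 < κ := by rw [hκ]; exact boxDensity_pos
  obtain ⟨KQ, hKQ⟩ : ∃ KQ : ℝ, KQ = max 1 ((2 * κ * 2 ^ d) ^ θ) := ⟨_, rfl⟩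
  have hKQ1 : 1 ≤ KQ := by rw [hKQ]; exact le_max_left _ _
  -- ## the cube bound with its constant
  obtain ⟨Cc, hCc⟩ : ∃ Cc : ℝ, ∀ N PL : ℝ, 0 < N → Real.log N = PL → ((4 * b₀ + 10 : ℕ) : ℝ) ^ 2 ≤ PL →
      PL ^ (pbig + b₀) ≤ N ^ η → PL ^ (pg + b₀) ≤ Real.exp (c * Real.sqrt (PL / 2)) →
      max x₀ 1 ≤ (N * ((PL ^ (b₀ + 2))⁻¹ / 2)) ^ d → 3 ≤ (N * ((PL ^ (b₀ + 2))⁻¹ / 2)) ^ d →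
      PL / 2 ≤ Real.log ((N * ((PL ^ (b₀ + 2))⁻¹ / 2)) ^ d) →
      PL ^ (2 * k₁) ≤ Real.log ((N * ((PL ^ (b₀ + 2))⁻¹ / 2)) ^ d) ^ ((2 * k₁ + 1 : ℕ) : ℝ) →
      KQ * N ^ (d * θ) ≤ N ^ d →
      ∀ M : ℝ, N ≤ M → M ≤ 2 * N → ∀ Q' : ℝ, PL ^ (2 * k₁) ≤ Q' → Q' ≤ KQ * N ^ (d * θ) →
        ∑ 𝔮 ∈ idealsLE K Q', Ecube K M 𝔮 ≤ Cc * N ^ d / PL ^ b₀ :=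
    ⟨_, fun N PL hN0 hNPL hPL hjunk hmits hx₀ hv3 hlogv hQA hKQN M hNM hM2 Q' hQ'1 hQ'2 =>
      cube_final hC hcore hCg0 hCg hCb1 hbal hc (le_max_right _ _) (by positivity) hP (le_max_right _ _) hCG hCI hI hCh hharm
        hCH hHQ hθ0 hθ hη0 hηθ hη1 hpA hdb hk₁ hpbig hpg rfl hKQ1 rfl rfl rfl hN0 hNPL hPL hjunk hmits hx₀ hv3 hlogv hQA hKQN
        hNM hM2 hQ'1 hQ'2⟩
  -- ## the eventual facts
  have f1 := Real.tendsto_log_atTop.eventually_ge_atTop (((4 * b₀ + 10 : ℕ) : ℝ) ^ 2)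
  have f2 := Real.tendsto_log_atTop.eventually_ge_atTop ((2 : ℝ) ^ (2 * k₁ + 1))
  have f3 := eventually_log_pow_le_rpow (pbig + b₀) hη0
  have f4 := eventually_log_pow_le_exp_sqrt (pg + b₀) hc
  have f5 := eventually_cardA_bounds (K := K)
  have f6 := eventually_log_pow_le_rpow (b₀ + 2) (by norm_num : (0 : ℝ) < 1 / 4)
  have f7 := (tendsto_rpow_atTop (by norm_num : (0 : ℝ) < 3 / 4)).eventually_ge_atTop (2 * (max x₀ 1 + 3))
  have f8 := (tendsto_rpow_atTop (by nlinarith : (0 : ℝ) < d * (1 - θ))).eventually_ge_atTop KQ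
  have f9 := eventually_log_pow_le_rpow (2 * k₁) (by positivity : (0 : ℝ) < d * θ)
  have f10 := eventually_ge_atTop (1 : ℝ)
  rw [← hκ] at f5
  obtain ⟨N₀, hN₀⟩ := Filter.eventually_atTop.1 (f1.and (f2.and (f3.and (f4.and (f5.and (f6.and (f7.and (f8.and (f9.and f10)))))))))
  -- ## conclusion
  refine ⟨2 * Cc * (2 / κ), N₀, fun N hN Q hQ => ?_⟩
  obtain ⟨hPL, h2k, hjunk, hmits, ⟨hAlo, hAhi⟩, hL14, hN34, hKQN', hU, hN1⟩ := hN₀ N hN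
  have hN0 : 0 < N := by linarith only [hN1]
  obtain ⟨PL, hPLdef⟩ : ∃ PL : ℝ, Real.log N = PL := ⟨_, rfl⟩
  rw [hPLdef] at hPL h2k hjunk hmits hL14 hU
  have hb : (10 : ℝ) ≤ (4 * b₀ + 10 : ℕ) := by exact_mod_cast (by omega : 10 ≤ 4 * b₀ + 10)
  have hPL100 : (100 : ℝ) ≤ PL := le_trans (by nlinarith only [hb]) hPL
  have hPL1 : 1 ≤ PL := by linarith only [hPL100]
  have hPL0 : 0 < PL := by linarith only [hPL100]
  -- ## the box conditions
  have hv : N ^ (3 / 4 : ℝ) / 2 ≤ N * ((PL ^ (b₀ + 2))⁻¹ / 2) := by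
    have h1 : 0 < PL ^ (b₀ + 2) := by positivity
    have hN14 : 0 < N ^ (1 / 4 : ℝ) := Real.rpow_pos_of_pos hN0 _
    have h2 : N * (N ^ (1 / 4 : ℝ))⁻¹ = N ^ (3 / 4 : ℝ) := by
      rw [← Real.rpow_neg hN0.le, ← Real.rpow_one_add' hN0.le (by norm_num)]
      norm_num
    have h3 : (N ^ (1 / 4 : ℝ))⁻¹ ≤ (PL ^ (b₀ + 2))⁻¹ := by
      rw [inv_le_inv₀ hN14 h1]; exact hL14
    calc N ^ (3 / 4 : ℝ) / 2 = N * (N ^ (1 / 4 : ℝ))⁻¹ / 2 := by rw [h2]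
      _ ≤ N * (PL ^ (b₀ + 2))⁻¹ / 2 := div_le_div_of_nonneg_right (mul_le_mul_of_nonneg_left h3 hN0.le) (by norm_num)
      _ = _ := by ring
  have hmax1 : (1 : ℝ) ≤ max x₀ 1 := le_max_right _ _
  have hv1 : max x₀ 1 + 3 ≤ N * ((PL ^ (b₀ + 2))⁻¹ / 2) := by linarith only [hv, hN34]
  have hvge1 : 1 ≤ N * ((PL ^ (b₀ + 2))⁻¹ / 2) := by linarith only [hv1, hmax1]
  have hvd : N * ((PL ^ (b₀ + 2))⁻¹ / 2) ≤ (N * ((PL ^ (b₀ + 2))⁻¹ / 2)) ^ d := le_self_pow₀ hvge1 (by omega)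
  have hx₀ : max x₀ 1 ≤ (N * ((PL ^ (b₀ + 2))⁻¹ / 2)) ^ d := by linarith only [hv1, hvd]
  have hv3 : 3 ≤ (N * ((PL ^ (b₀ + 2))⁻¹ / 2)) ^ d := by linarith only [hv1, hvd, hmax1]
  have hlogv : PL / 2 ≤ Real.log ((N * ((PL ^ (b₀ + 2))⁻¹ / 2)) ^ d) := by
    have h1 : Real.log (N ^ (3 / 4 : ℝ) / 2) ≤ Real.log (N * ((PL ^ (b₀ + 2))⁻¹ / 2)) := Real.log_le_log (by positivity) hv
    rw [Real.log_div (Real.rpow_pos_of_pos hN0 _).ne' two_ne_zero, Real.log_rpow hN0, hPLdef] at h1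
    have hl2 : Real.log 2 ≤ 1 := by have := Real.log_two_lt_d9; linarith only [this]
    have h2 : Real.log (N * ((PL ^ (b₀ + 2))⁻¹ / 2)) ≤ Real.log ((N * ((PL ^ (b₀ + 2))⁻¹ / 2)) ^ d) := by
      rw [Real.log_pow]
      exact le_mul_of_one_le_left (Real.log_nonneg hvge1) hdR
    linarith only [h1, h2, hl2, hPL100]
  have hQA : PL ^ (2 * k₁) ≤ Real.log ((N * ((PL ^ (b₀ + 2))⁻¹ / 2)) ^ d) ^ ((2 * k₁ + 1 : ℕ) : ℝ) := by
    rw [Real.rpow_natCast]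
    have h1 : (PL / 2) ^ (2 * k₁ + 1) ≤ Real.log ((N * ((PL ^ (b₀ + 2))⁻¹ / 2)) ^ d) ^ (2 * k₁ + 1) :=
      pow_le_pow_left₀ (by positivity) hlogv _
    refine le_trans ?_ h1
    rw [div_pow, pow_succ, le_div_iff₀ (by positivity)]
    exact mul_le_mul_of_nonneg_left h2k (by positivity)
  have hKQN : KQ * N ^ (d * θ) ≤ N ^ d := by
    have h1 : N ^ (d * (1 - θ)) * N ^ (d * θ) = N ^ d := by
      rw [← Real.rpow_add hN0, ← Real.rpow_natCast]; ring_nf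
    rw [← h1]
    exact mul_le_mul_of_nonneg_right hKQN' (Real.rpow_nonneg hN0.le _)
  -- ## `Q' = max(Q, PL^{2k₁})`
  have hQ' : max Q (PL ^ (2 * k₁)) ≤ KQ * N ^ (d * θ) := by
    refine max_le ?_ (hU.trans (le_mul_of_one_le_left (Real.rpow_nonneg hN0.le _) hKQ1))
    refine hQ.trans ?_
    have hA0 : (0 : ℝ) ≤ cardA K N := Nat.cast_nonneg _
    calc (cardA K N : ℝ) ^ θ ≤ (2 * κ * (2 * N) ^ d) ^ θ := Real.rpow_le_rpow hA0 hAhi hθ0.le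
      _ = (2 * κ * 2 ^ d) ^ θ * N ^ (d * θ) := by
          rw [mul_pow, ← mul_assoc, Real.mul_rpow (by positivity) (by positivity), ← Real.rpow_natCast N d,
            ← Real.rpow_mul hN0.le]
      _ ≤ KQ * N ^ (d * θ) := by
          refine mul_le_mul_of_nonneg_right ?_ (Real.rpow_nonneg hN0.le _)
          rw [hKQ]; exact le_max_right _ _
  -- ## the two cubes
  have h2N := hCc N PL hN0 hPLdef hPL hjunk hmits hx₀ hv3 hlogv hQA hKQN (2 * N) (by linarith only [hN0]) le_rfl _
    (le_max_right _ _) hQ'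
  have h1N := hCc N PL hN0 hPLdef hPL hjunk hmits hx₀ hv3 hlogv hQA hKQN N le_rfl (by linarith only [hN0]) _
    (le_max_right _ _) hQ'
  have hE0 : 0 ≤ ∑ 𝔮 ∈ idealsLE K (max Q (PL ^ (2 * k₁))), Ecube K N 𝔮 :=
    Finset.sum_nonneg fun 𝔮 _ => Real.iSup_nonneg fun _ => abs_nonneg _
  have hpos : 0 < N ^ d / PL ^ b₀ := by positivity
  have hCc0 : 0 ≤ Cc := by
    by_contra hneg
    push Not at hneg
    have h1 : Cc * (N ^ d / PL ^ b₀) < 0 := mul_neg_of_neg_of_pos hneg hpos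
    have h2 : Cc * N ^ d / PL ^ b₀ = Cc * (N ^ d / PL ^ b₀) := mul_div_assoc _ _ _
    linarith only [hE0, h1N, h1, h2]
  -- ## assemble
  have hsum : ∑ 𝔮 ∈ idealsLE K Q, primesAErr K N 𝔮 ≤ 2 * Cc * N ^ d / PL ^ b₀ := by
    calc ∑ 𝔮 ∈ idealsLE K Q, primesAErr K N 𝔮 ≤ ∑ 𝔮 ∈ idealsLE K (max Q (PL ^ (2 * k₁))), primesAErr K N 𝔮 :=
          sum_primesAErr_mono N (le_max_left _ _)
      _ ≤ ∑ 𝔮 ∈ idealsLE K (max Q (PL ^ (2 * k₁))), (Ecube K (2 * N) 𝔮 + Ecube K N 𝔮) :=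
          Finset.sum_le_sum fun 𝔮 h𝔮 => primesAErr_le_Ecube_add hN0.le (mem_idealsLE.1 h𝔮).1
      _ = _ := Finset.sum_add_distrib
      _ ≤ Cc * N ^ d / PL ^ b₀ + Cc * N ^ d / PL ^ b₀ := add_le_add h2N h1N
      _ = 2 * Cc * N ^ d / PL ^ b₀ := by ring
  rw [hPLdef]
  refine hsum.trans ?_
  -- `N^d ≤ (2/κ) |A(N)|` and `PL^B ≤ PL^{b₀}`
  have hNA : N ^ d ≤ 2 / κ * cardA K N := by
    have h1 : N ^ d ≤ (2 * N) ^ d := pow_le_pow_left₀ hN0.le (by linarith only [hN0]) d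
    have h2 : (2 * N) ^ d ≤ 2 / κ * cardA K N := by
      rw [div_mul_eq_mul_div, le_div_iff₀ hκ0]
      linarith only [hAlo]
    exact h1.trans h2
  have hPLB : PL ^ B ≤ PL ^ b₀ := by
    rw [← Real.rpow_natCast PL b₀]
    exact Real.rpow_le_rpow_of_exponent_le hPL1 (by rw [hb₀]; exact Nat.le_ceil B)
  have hPLB0 : 0 < PL ^ B := Real.rpow_pos_of_pos hPL0 B
  calc 2 * Cc * N ^ d / PL ^ b₀ ≤ 2 * Cc * (2 / κ * cardA K N) / PL ^ b₀ :=
        div_le_div_of_nonneg_right (mul_le_mul_of_nonneg_left hNA (by positivity)) (by positivity)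
    _ = 2 * Cc * (2 / κ) * cardA K N / PL ^ b₀ := by ring
    _ ≤ 2 * Cc * (2 / κ) * cardA K N / PL ^ B := div_le_div_of_nonneg_left (by positivity) hPLB0 hPLB

/-- **Theorem 2.7 of Castillo et al. (Hinz's theorem, totally real fields) from Mitsui's prime
number theorem for classes in balanced boxes** (for all totally real `K`).
[cite: CastilloEtAl2015, Theorem 2.7 (r₂ = 0)] -/
theorem castilloEtAl2015_thm_2_7_hinz_of_PNT
    (hPNT : ∀ (K : Type) [Field K] [NumberField K] [IsTotallyReal K], ∀ c₁ c₂ : ℝ, 0 < c₁ → c₁ ≤ c₂ → ∀ A : ℝ, 0 < A →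
      ∃ c : ℝ, 0 < c ∧ ∃ C x₀ : ℝ, ∀ y : {w : InfinitePlace K // IsReal w} → ℝ, x₀ ≤ ∏ w, y w →
        (∀ w, c₁ * (∏ w', y w') ^ (1 / (Module.finrank ℚ K : ℝ)) ≤ y w ∧
          y w ≤ c₂ * (∏ w', y w') ^ (1 / (Module.finrank ℚ K : ℝ))) →
        ∀ 𝔮 : Ideal (𝓞 K), 𝔮 ≠ ⊥ → (Ideal.absNorm 𝔮 : ℝ) ≤ Real.log (∏ w, y w) ^ A →
        ∀ γ : (𝓞 K ⧸ 𝔮)ˣ, |(primeBoxCount K y 𝔮 (γ : 𝓞 K ⧸ 𝔮) : ℝ) - mitsuiMain K y / Nat.card ((𝓞 K ⧸ 𝔮)ˣ)| ≤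
          C * (∏ w, y w) * Real.exp (-(c * Real.sqrt (Real.log (∏ w, y w))))) :
    castilloEtAl2015_thm_2_7_hinz :=
  fun K _ _ _ _ h0 h => primesHaveLevel_of_PNT (hPNT K) h0 h

/-- **Theorem 1.1 of Castillo et al. (totally real fields) from Mitsui's prime number theorem for
classes in balanced boxes.** [cite: CastilloEtAl2015, Theorem 1.1, §3.1] -/
theorem castilloEtAl2015_thm_1_1_totallyReal_of_PNT
    (hPNT : ∀ (K : Type) [Field K] [NumberField K] [IsTotallyReal K], ∀ c₁ c₂ : ℝ, 0 < c₁ → c₁ ≤ c₂ → ∀ A : ℝ, 0 < A →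
      ∃ c : ℝ, 0 < c ∧ ∃ C x₀ : ℝ, ∀ y : {w : InfinitePlace K // IsReal w} → ℝ, x₀ ≤ ∏ w, y w →
        (∀ w, c₁ * (∏ w', y w') ^ (1 / (Module.finrank ℚ K : ℝ)) ≤ y w ∧
          y w ≤ c₂ * (∏ w', y w') ^ (1 / (Module.finrank ℚ K : ℝ))) →
        ∀ 𝔮 : Ideal (𝓞 K), 𝔮 ≠ ⊥ → (Ideal.absNorm 𝔮 : ℝ) ≤ Real.log (∏ w, y w) ^ A →
        ∀ γ : (𝓞 K ⧸ 𝔮)ˣ, |(primeBoxCount K y 𝔮 (γ : 𝓞 K ⧸ 𝔮) : ℝ) - mitsuiMain K y / Nat.card ((𝓞 K ⧸ 𝔮)ˣ)| ≤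
          C * (∏ w, y w) * Real.exp (-(c * Real.sqrt (Real.log (∏ w, y w))))) :
    castilloEtAl2015_thm_1_1_totallyReal :=
  castilloEtAl2015_thm_1_1_totallyReal_holds_of (castilloEtAl2015_thm_2_7_hinz_of_PNT hPNT)

end Literature.NumberTheory.Sieve.BVAssembly
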